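import Mathlib
import Literature.MathematicalPhysics.QuantumFieldTheory.Balaban1983to89.B9Eq3152
import Literature.MathematicalPhysics.QuantumFieldTheory.Balaban1983to89.B9SectEKernel

/-! # `Balaban1983to89.B9Eq3112` — B9 p. 417 (3.109)–(3.112) and p. 428 (3.159): the variational problem with the
# DOUBLE constraint `δ(QA − B)δ_R(RD*A)` AT MEASURE LEVEL — the hyperplane (3.110) as one full-row-rank matrix, (3.111),
# the unique minimiser `H`, the δ-gauge mean (3.112), the END-TO-END identity «minimiser of (3.109)–(3.110) = (3.126)
# `GQ*(QGQ*)⁻¹`» WITHOUT the Faddeev–Popov route (3.118)–(3.125), and the inner representation (3.159) with a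
# `B`-independent normalisation

CITATION HEADER.  Unit `b2b-balaban-b09` (gen 15, cell pub-balaban), PAPER SUB-CELL B09 =
T. Balaban, *Propagators for lattice gauge theories in a background field*, Commun. Math. Phys. **99** (1985) 389–434
[`Balaban1985BackgroundPropagators`] (= B9).  p. 417 [PDF 29], p. 419 [PDF 31], p. 420 [PDF 32], p. 427 [PDF 39],
p. 428 [PDF 40] (renders `1985-cmp99-background-propagators-p029-x2.png`, `…-p031-x2.png`, `…-p032-x2.png`, `…-p039-x2.png`,
`…-p040-x2.png`, READ AS IMAGES — the Euclid text layer is unreliable), verbatim: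
p. 417: *"For a configuration B defined on 𝔅 and with values in the Lie algebra 𝔤 we define H(U)B, or simply HB, as a
minimal configuration of the functional A → ½⟨A, Δ(U)A⟩, (3.109) on a set of configurations A defined on Ω₀, with
values in 𝔤, satisfying L^jηQ_j(U)A = B on Λ_j, j = 0,1,…,k, R(U)D\*_U A = 0. (3.110) […] In the future we will write
the first condition in (3.110) as Q(U)A = B. The variational problem (3.109), (3.110) has a unique solution. Indeed,
the functional (3.109) is equal to A → ½⟨A,(Δ + DRD\* + Q\*aQ)A⟩ − ½⟨B,aB⟩ = ½⟨A,Δ_aA⟩ − ½⟨B,aB⟩ (3.111) on the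
hyperplane (3.110), hence the existence of a unique minimum on this hyperplane follows from positive definiteness of the
operator Δ_a. This minimum is denoted by HB. It define a linear operator H. We would like to represent this operator in
terms of the already introduced operators, similarly to (1.103) in [3] and (2.35) in [4]. We will follow the method of
[4], Sect. A. Let us start with an integral representation of HB. […] We have
HB = Z⁻¹(B)∫dA δ(QA − B)δ_R(RD\*A)e^{−(1/2)⟨A,ΔA⟩}A, (3.112) where Z(B) is given by the same integral with the last A
replaced by 1. This formula can be proved easily by making the translation A = A′ + HB and then noticing that the term
with A′ vanishes, and the coefficient at HB cancels with Z⁻¹(B). The integrals in (3.112) are convergent because on the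
domains of integration we can replace the form 1/2⟨A,ΔA⟩ by the right-hand side of (3.111), and we can use again the
positive definiteness of Δ_a."*
p. 419: *"… now let us proceed with the derivation of a formula for HB. We replace the operator Δ by Δ_π in (3.112), and we
apply the Faddeev–Popov procedure HB = Z⁻¹(B)∫dA δ(QA − B)δ_R(RD\*A)e^{−(1/2)⟨A,Δ_πA⟩}A · Z′⁻¹∫dλ δ(Q′λ)e^{−(1/2)‖RD\*A−Δλ‖²}
= … (3.121)"*
p. 420: *"To calculate the last integral we have to find a minimum of the functional A → ½⟨A,(Δ_π + DRD\*)A⟩ = ½⟨A,G⁻¹A⟩ −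
½⟨B,aB⟩ (3.122) on configurations A satisfying QA = B, and G⁻¹ defined as G⁻¹ = Δ_π + DRD\* + Q\*aQ. Now this is an easy
problem. … hence A = GQ\*ω, QGQ\*ω = B, ω = (QGQ\*)⁻¹B, and finally A = GQ\*(QGQ\*)⁻¹B. … RD\*GQ\* = 0, hence QGDR = 0.
(3.124) … Thus the identities (3.124) are proved. They imply the formula HB = GQ\*(QGQ\*)⁻¹B. (3.126) We have obtained
formally the same representation for the operator H as in [3,4] (1.103), (2.35), but now the operator G is much more
complicated."*
p. 427: *"e^{(1/2)⟨g,C^{(k)}(Λ)g⟩} = (Z^{(k)}(Λ))⁻¹∫dB↾_Λ δ(Q₁B)δ_{Ax}(B) · exp[−½⟨H₁B, G₁⁻¹H₁B⟩ + ½a⟨B,B⟩ + ⟨H₁D̃^{(2)}(B), J⟩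
+ ⟨B, g⟩], (3.155)"*;  p. 428: *"To get the desired representation we transform the integral in (3.155). At first we
replace the exponential with the first two quadratic forms by the integral representation
exp(½⟨g, C^{(k)}(Λ)g⟩) = (Z^{(k)}(Λ))⁻¹∫dB↾_Λ δ(Q₁B)δ_{Ax}(B) × exp[⟨H₁D̃^{(2)}(B), J⟩ + ⟨B, g⟩]
× Z_k⁻¹∫dA δ(QA − B)δ_R(RD\*A) × exp[−½⟨A,(Δ + Δ^{(2)})A⟩]. (3.159)"*

THE POINT.  The lineage has certified, around this paragraph: [an2's] bordered-matrix ("KKT") algebra of a quadratic form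
under ONE linear constraint (`Beta.CompositionSingular`: `minOp`, `flucCov`, `blocks_mul_kkt`, …) and its three-block
refinement `Beta.GaugeFixingPropagators.inv_mul_transpose_mul_blockProp_inv`; [g13's] `B9SectECov` (kernel-basis Gaussian
integrals, `R = ΔN(NᵀΔ²N)⁻¹NᵀΔ`); [g14's] `B9SectDFP` (Sect. D's own objects `T = 1 − DG′RD*`, `Δ_π = TᵀKT`,
`G⁻¹ = Δ_π + DRD* + Q*aQ`, the Lagrange computation (3.122)–(3.126) GIVEN (3.124), the constrained Gaussian mean
`constrainedMean`) and `B9Eq3152` ((3.124)/(3.151)–(3.152) as operator identities).  What was NOT yet in the tree is the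
paragraph that DEFINES `H`: the variational problem (3.109) under the DOUBLE constraint (3.110) — `QA = B` AND the gauge
condition `RD*A = 0` — its unique solvability from `Δ_a > 0` ((3.111)), the δ-function representation (3.112), and the
fact that the `H` so defined IS the `GQ*(QGQ*)⁻¹` of (3.126).  The print reaches (3.126) from (3.112) through the
Faddeev–Popov insertion (3.118)/(3.121) and the Gaussian manipulation (3.125).  THIS FILE types (3.109)–(3.112) directly
and reaches (3.126) by finite-dimensional linear algebra alone:
(i) THE FRAME (§1).  The second constraint `RD*A = 0` has the rank-deficient matrix `RD*` (`n` rows, rank `dim N(Q′)`); it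
is replaced by the equivalent full-row-rank SLICE `τ₀ := NᵀΔD*` (`RD*A = 0 ⟺ τ₀A = 0`, since `R` is the orthogonal
projection onto `ΔN(Q′)`), and (3.110) becomes `SA = (B, 0)` for the stacked `S := [Q_b ; τ₀]`, which has full row rank
(`SSᵀ` nonsingular: tested on the gauge modes `DN`, using (3.115) `Q_bD = D̄Q′` and `NᵀΔ²N` nonsingular).
(ii) (3.111) AND UNIQUENESS (§2).  On the hyperplane, `⟨A,KA⟩ = ⟨A,Δ_aA⟩ − a‖B‖²`, `Δ_a = K + DRD* + Q*aQ` (`eq_3111`);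
`Δ_a > 0` makes `K` positive definite along `ker S` (`kernelForm_posDef`), hence the bordered matrix of `(K, S)`
nonsingular (`isUnit_kkt_dcon`); `H` := the `B`-column block of [an2's] `minOp K S` (`hOp`); the action splits
`⟨A,KA⟩ = ⟨HB,K·HB⟩ + ⟨A − HB, K(A − HB)⟩` on the hyperplane (`eq_3109_split` — the print's *"translation A = A′ + HB"*)
and `HB` is the unique minimum (`eq_3109_min`).
(iii) (3.112) AT MEASURE LEVEL (§3).  Over a kernel-basis parametrisation `A = A₀ + N_Sz` of the double fibre, the
`e^{−½⟨A,KA⟩}`-weighted mean of `A` is `HB` (`eq_3112`, `eq_3112_normalised`, `Z(B) > 0`), with `Z(B)` in closed form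
(`Z_eq`: `(√2π)^{dim}/√det(N_SᵀKN_S) · e^{−½⟨HB,K·HB⟩}`).
(iv) (3.109)–(3.110) ⟹ (3.126) END-TO-END (§4, `hOp_mulVec_eq_3126`, `H_eq_3126`).  The vector `x = GQ_bᵀ(Q_bGQ_bᵀ)⁻¹B`
satisfies `Q_bx = B`, `RD*x = 0` ((3.124)), `Tx = x`, and `G⁻¹x = Q_bᵀω`; expanding `G⁻¹x = Tᵀ(Kx) + aQ_bᵀB` and
`Tᵀ = 1 − DRG′D*`, `DR = τ₀ᵀ(NᵀΔ²N)⁻¹NᵀΔ` shows `Kx ∈ Ran Sᵀ`, and KKT UNIQUENESS for the nonsingular bordered matrix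
(`eq_minOp_of_kkt`: `Hx = Sᵀλ ⟹ x = ℋ(Sx)`) gives `x = HB`.  Under `Δ_a > 0` every nonsingularity input is discharged
(`H_eq_3126`: `H = GQ*(QGQ*)⁻¹` as matrices).  [an2's] three-block theorem, instantiated BY NAME for Sect. D's objects
(`eq_3126_threeBlock`), adds that the print's replacement *"Δ by Δ_π in (3.112)"* (p. 419) does not move the minimiser
(`minOp_piOp_eq_hOp`).
(v) (3.159) (§5).  For EVERY symmetric bond form `K♯` with `Δ_a(K♯) > 0` the double-fibre Gaussian integral is
`𝒩 · exp[−½⟨HB,G⁻¹HB⟩ + ½a⟨B,B⟩]` with `𝒩 = (√2π)^{dim}/√det(N_SᵀK♯N_S)` INDEPENDENT OF `B` (`eq_3159`, `eq_3159_print`) —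
which is what lets (3.159) divide by a constant `Z_k`; and the first step of (3.156), `⟨H₁B,G₁⁻¹H₁B⟩ = ⟨B,(QG₁Q*)⁻¹B⟩`, is
[r1-g4's] `B9SectEKernel.extension_energy` with its hypotheses discharged (`minOp_quadForm`, `eq_3156_energy`,
`min_3109_value`).

WHAT THIS FILE CERTIFIES (kernel; finite index types as in `B9SectDFP`: `n` sites (`Δ = D*D`, `Q′ : m × n` with kernel
basis `N : n × τ`, `Q′N = 0`, `n ≃ τ ⊕ m`), `b` bonds (bond form `K : b × b`, `D : b × n`, `DᵀD = Δ`), `q` rows of the bond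
averaging `Q_b` (`Q_bD = D̄Q′`, (3.115)), a kernel basis `N_S : b × σ` of `S` (`SN_S = 0`, `N_SᵀN_S` nonsingular,
`b ≃ σ ⊕ (q ⊕ τ)`); `R`, `G′`, `Δ′`, `M′` = [adv1's] `B9H163.R/.G'/.Δ'/.M'`; `T`, `Δ_π`, `G⁻¹` = [g14's]
`B9SectDFP.tOp/.piOp/.Ginv`; `ℋ = minOp`, `kkt`, `blockProp` = [an2's] `Beta.CompositionSingular` / `Beta.Composition`):
0. §0 [folklore]: `sumElim_eq_sumElim_iff`, `sumElim_zero_zero`; `eq_minOp_of_kkt` (KKT uniqueness); `isUnit_det_QHinvQt`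
   (`QH⁻¹Qᵀ` nonsingular for `H > 0`, `Q` onto); `minOp_quadForm` (`⟨ℋB,HℋB⟩ = ⟨B,(QH⁻¹Qᵀ)⁻¹B⟩`, [r1-g4's]
   `extension_energy` BY NAME); `fibreGaussian` (the Gaussian integral over an affine fibre in a kernel basis).
1. §1 `slice`, `dcon` (= `S`), `slice_mul_gauge`, `R_Dt_mulVec_eq_zero_iff`, `dcon_mulVec_eq_iff` ((3.110) ⟺ `SA = (B,0)`),
   `dcon_kernel`, `dcon_gram` (`SSᵀ` nonsingular).
2. §2 `eq_3111`, `Ginv_quadForm_gaugeFixed` (`⟨A,G⁻¹A⟩ = ⟨A,KA⟩ + a‖Q_bA‖²` on `{RD*A = 0}`), `kernelForm_posDef`,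
   `isUnit_kkt_dcon`, `hOp` (= `H`), `hOp_mulVec`, `dcon_hOp_mulVec`, `hOp_feasible`, `eq_3109_split`, `eq_3109_min`.
3. §3 `eq_3112`, `Z_eq`, `Z_pos`, `eq_3112_normalised`.
4. §4 `hOp_mulVec_eq_3126` (`HB = ℋ_{G⁻¹,Q_b}B = GQ_bᵀ(Q_bGQ_bᵀ)⁻¹B`, given the three nonsingularities), `H_eq_3126` (the
   matrix identity from `Δ_a > 0` alone), `eq_3126_threeBlock`, `minOp_piOp_eq_hOp`.
5. §5 `eq_3159`, `eq_3159_print`, `eq_3156_energy`, `min_3109_value`.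
WHAT IT DOES NOT CERTIFY: the Faddeev–Popov identities (3.118), (3.121), (3.125) themselves (measure manipulations with
`|det(Δ↾_{N(Q′)})|`, `Z′`; the END identity (3.126) they serve is certified here by the algebraic route, and (3.124) by
[g14's] `B9Eq3152`/`B9SectDFP`); the operators `Q_j(U)`, `L^jη`, `R(U)`, `D_U`, `Δ(U)` as functions of the background field
`U` (only their matrices at fixed `U` enter, as hypotheses-free variables `Qb`, `D`, `K`, …); the `J`-dependent terms
`⟨H₁D̃^{(2)}(B),J⟩`, `⟨B,g⟩` and the outer `dB`-integral of (3.155)/(3.159), `C^{(k)}(Λ)`, `Z^{(k)}(Λ)`; the regularity /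
decay properties of `H`, `G` (Theorems 3.10–3.13, analytic); the identification of `Z_k` with a specific constant (only
its `B`-independence, which is what (3.159) uses); the constant Jacobian between `δ(QA − B)δ_R(RD*A)dA` and Lebesgue
measure `dz` on the parametrised fibre (it cancels in (3.112) and is absorbed in `Z_k` in (3.159)) and the normalisation
(3.17) of `δ_R`.
READING NOTE ((3.159), LOW): (3.159) prints the bond form as `Δ + Δ^{(2)}`, while (3.127) *"A → ½⟨A,ΔA⟩ − ⟨HC^{(2)}(A),J⟩"*
with (3.134) *"⟨A,Δ^{(2)}A⟩ = 2⟨HC^{(2)}(A),J⟩"* reads `½⟨A,(Δ − Δ^{(2)})A⟩`, and (3.128)/(3.138) carry the same `−`; this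
is one more display in the pp. 424–425 sign convention already recorded in the cell (GAPS G-adv7-4, displays
(3.141)–(3.149)).  Immaterial here: every theorem of §5 is stated for an ARBITRARY symmetric bond form `K♯` (instance: the
matrix `K − 2𝒞` of (3.127), [g14's] `B9Eq3152.G1inv K C = Ginv (K − 2C)`), whichever sign the print intends.
MODELLING / DIVERGENCE (recorded as D-b09.56): (a) as D-b09.53/54 (two `Δ`'s: the bond form `K` of (3.109)/(3.112) vs the
site Laplacian `Δ = DᵀD` inside `R`, `G′`; real entries, `*` ↦ `ᵀ`, `Q*aQ ↦ a_b·Q_bᵀQ_b`; arbitrary finite index types);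
(b) `δ(QA − B)δ_R(RD*A)dA` ↦ Lebesgue measure `dz` on `σ → ℝ` through `A = A₀ + N_Sz`, `N_S` a kernel basis of
`S = [Q_b ; NᵀΔD*]` — the gauge δ-function `δ_R(RD*A)` (supported on `{RD*A = 0}`, (3.17)) is imposed as the linear
constraint `NᵀΔD*A = 0`, equivalent to it (`R_Dt_mulVec_eq_zero_iff`); (c) `H ↦ hOp K Δ N D Qb := (minOp K S).toCols₁`;
(d) *"positive definiteness of Δ_a"* ↦ the hypothesis `hΔa : (K + D·R·Dᵀ + ab·QbᵀQb).PosDef` (the print's `Δ_a`,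
(3.111); never `K + ab·QbᵀQb > 0` on all of `ℝ^b`, cf. D-b09.55); (e) (3.159)'s `Δ + Δ^{(2)}` ↦ an arbitrary symmetric
`K♯`, `Z_k ↦ (√2π)^{|σ|}/√det(N_SᵀK♯N_S)`.
NON-VACUITY (exact toy check, pure-python `Fraction` arithmetic, recorded with GAPS C-B9-77): on the `4 × 4` torus with
`2 × 2` blocks (`n = 16`, `b = 32`, `m = 4`, `q = 8`, `τ = 12`, `σ = 12`), with `Q_b` the block-averaged straight-line
bond sum (so that (3.115) holds exactly), `a = 13/10`, `a_b = 7/10` and a generic symmetric `K` killing the gauge modes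
`DN`: every hypothesis of `H_eq_3126` holds (`Δ_a > 0` while `K` alone is NOT positive definite), and `H = GQ_bᵀ(Q_bGQ_bᵀ)⁻¹`,
`(minOp Δ_π S).toCols₁ = H`, `⟨HB,KHB⟩ = ⟨HB,G⁻¹HB⟩ − a‖B‖² = ⟨B,(Q_bGQ_bᵀ)⁻¹B⟩ − a‖B‖²` and "fibre Gaussian mean = HB" hold
EXACTLY.
RECORDS: GAPS C-B9-77, C-B9-79 (v1.1); DIVERGENCE D-b09.56.  No `sorry`, no new axioms (`propext`, `Classical.choice`,
`Quot.sound` only).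

VERSIONS.  v1 = p190447 (gen 15).  v1.1 (gen 16) = DOCSTRING-ONLY quotation hygiene answering G-ref1-27 (referee R212.2)
= pv14-g16 XREAD D1 (C-pv14-108): in the p. 417 quotation two bridging glosses of v1 («Thus we have to find a minimum of
the functional … under the conditions», «This operator can be represented by the Gaussian integral») are replaced by the
print's own sentences (re-read on the p. 417 render AS IMAGE), omissions marked […]; every declaration, statement and
proof byte-identical to v1.
NOT summit progress; NOT continuum; NOT Clay. -/

namespace Literature.MathematicalPhysics.QuantumFieldTheory.Balaban1983to89.B9Eq3112

open Matrix MeasureTheory Real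
open scoped Matrix
open Literature.MathematicalPhysics.QuantumFieldTheory.Balaban1983to89.Beta.Composition (kkt blockProp)
open Literature.MathematicalPhysics.QuantumFieldTheory.Balaban1983to89.Beta.CompositionSingular
open Literature.MathematicalPhysics.QuantumFieldTheory.Balaban1983to89.B9SectDFP (tOp piOp Ginv)

/-! ## §0  Two pieces of linear algebra: block vectors, and KKT uniqueness for the bordered matrix -/

section Helpers

/-- Block vectors are equal iff their blocks are. [folklore] -/
theorem sumElim_eq_sumElim_iff {α β γ : Type*} (f f' : α → γ) (g g' : β → γ) :
    Sum.elim f g = Sum.elim f' g' ↔ f = f' ∧ g = g' := by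
  constructor
  · intro h
    exact ⟨funext fun a => by simpa using congrFun h (Sum.inl a),
      funext fun b => by simpa using congrFun h (Sum.inr b)⟩
  · rintro ⟨rfl, rfl⟩
    rfl

/-- `(0, 0) = 0` as a block vector. [folklore] -/
theorem sumElim_zero_zero {α β γ : Type*} [Zero γ] : Sum.elim (0 : α → γ) (0 : β → γ) = 0 :=
  funext fun i => by cases i <;> rfl

variable {ν μ : Type*} [Fintype ν] [Fintype μ] [DecidableEq ν] [DecidableEq μ]

/-- KKT UNIQUENESS for a nonsingular bordered matrix `[[H, Qᵀ],[Q, 0]]`: a configuration `x` whose "gradient" `Hx` is a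
combination of the constraint rows, `Hx = Qᵀλ`, IS the constrained critical point with its own constraint values:
`x = ℋ(Qx)`, `ℋ = minOp H Q` ([an2's] bordered-inverse blocks: `𝒢H + ℋQ = 1`, `𝒢Qᵀ = 0`).  No invertibility or
symmetry of `H`. [folklore] -/
theorem eq_minOp_of_kkt (H : Matrix ν ν ℝ) (Q : Matrix μ ν ℝ) (h : IsUnit (kkt H Q).det) (x : ν → ℝ) (lam : μ → ℝ)
    (hEL : H *ᵥ x = Qᵀ *ᵥ lam) : x = minOp H Q *ᵥ (Q *ᵥ x) := by
  obtain ⟨h1, h2, -, -⟩ := blocks_mul_kkt H Q h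
  calc x = (flucCov H Q * H + minOp H Q * Q) *ᵥ x := by rw [h1, one_mulVec]
    _ = flucCov H Q *ᵥ (Qᵀ *ᵥ lam) + minOp H Q *ᵥ (Q *ᵥ x) := by
        rw [add_mulVec, ← mulVec_mulVec, ← mulVec_mulVec, hEL]
    _ = minOp H Q *ᵥ (Q *ᵥ x) := by rw [mulVec_mulVec, h2, zero_mulVec, zero_add]

/-- `QH⁻¹Qᵀ` is nonsingular for `H` positive definite and `Q` onto (`QQᵀ` nonsingular). [folklore] -/
theorem isUnit_det_QHinvQt (H : Matrix ν ν ℝ) (hH : H.PosDef) (Q : Matrix μ ν ℝ) (hQM : IsUnit (Q * Qᵀ).det) :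
    IsUnit (Q * H⁻¹ * Qᵀ).det := by
  have hinj : Function.Injective Q.vecMul := by
    intro x₁ x₂ hx
    rw [← sub_eq_zero] at hx ⊢
    rw [← sub_vecMul] at hx
    exact B9SectECov.eq_zero_of_constraint hQM hx
  have hpd : (Q * H⁻¹ * Qᵀ).PosDef := by
    simpa only [conjTranspose_eq_transpose_of_trivial] using hH.inv.mul_mul_conjTranspose_same hinj
  exact (Matrix.isUnit_iff_isUnit_det _).mp hpd.isUnit

/-- THE VALUE OF THE FORM ON THE LAGRANGE MINIMISER: for nonsingular `H` with `QH⁻¹Qᵀ` nonsingular,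
`⟨ℋB, H ℋB⟩ = ⟨B, (QH⁻¹Qᵀ)⁻¹B⟩`, `ℋ = minOp H Q = H⁻¹Qᵀ(QH⁻¹Qᵀ)⁻¹` — [r1-g4's] `B9SectEKernel.extension_energy` BY NAME,
its hypotheses `Qℋ = 1`, `Hℋ = QᵀP` discharged for the Lagrange operator of B9 p. 420. [folklore] -/
theorem minOp_quadForm (H : Matrix ν ν ℝ) (Q : Matrix μ ν ℝ) (hH : IsUnit H.det) (hP : IsUnit (Q * H⁻¹ * Qᵀ).det)
    (B : μ → ℝ) : (minOp H Q *ᵥ B) ⬝ᵥ H *ᵥ (minOp H Q *ᵥ B) = B ⬝ᵥ (Q * H⁻¹ * Qᵀ)⁻¹ *ᵥ B := by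
  have hQH : Q * (H⁻¹ * Qᵀ * (Q * H⁻¹ * Qᵀ)⁻¹) = 1 := by
    simp only [← Matrix.mul_assoc]
    rw [mul_nonsing_inv _ hP]
  have hSH : H * (H⁻¹ * Qᵀ * (Q * H⁻¹ * Qᵀ)⁻¹) = Qᵀ * (Q * H⁻¹ * Qᵀ)⁻¹ := by
    simp only [← Matrix.mul_assoc]
    rw [mul_nonsing_inv _ hH, Matrix.one_mul]
  rw [minOp_eq_minMap H Q hH hP]
  exact B9SectEKernel.extension_energy H Q _ _ hQH hSH B

/-- THE GAUSSIAN INTEGRAL OVER AN AFFINE FIBRE `{A : QA = QA₀}` parametrised by a kernel basis, `A = A₀ + Nz`: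
`∫dz e^{−½⟨A,SA⟩} = (√2π)^{dim}/√det(NᵀSN) · e^{−½⟨A⋆,SA⋆⟩}`, `A⋆ = ℋ(QA₀)` the constrained minimiser — the prefactor
depends on the fibre DIRECTION only, not on `A₀` (translation `A₀ = A⋆ + Nz₁`, [g13's] `B9SectECov.action_translation`,
[pv16's] `Beta.GaussianIntegral.integral_exp_neg_half_quadForm`). [folklore] -/
theorem fibreGaussian {ι κ ρ : Type*} [Fintype ι] [Fintype κ] [Fintype ρ] [DecidableEq ι] [DecidableEq κ]
    [DecidableEq ρ] (e : ι ≃ ρ ⊕ κ) (S : Matrix ι ι ℝ) (hS : Sᵀ = S) (Q : Matrix κ ι ℝ) (N : Matrix ι ρ ℝ)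
    (hQN : Q * N = 0) (hNA : IsUnit (Nᵀ * N).det) (hQM : IsUnit (Q * Qᵀ).det) (hT : (Nᵀ * S * N).PosDef)
    (A₀ : ι → ℝ) :
    ∫ z : ρ → ℝ, Real.exp (-(1/2 : ℝ) * ((A₀ + N *ᵥ z) ⬝ᵥ S *ᵥ (A₀ + N *ᵥ z))) =
      (Real.sqrt (2 * π) ^ Fintype.card ρ / Real.sqrt (Nᵀ * S * N).det) *
        Real.exp (-(1/2 : ℝ) * ((minOp S Q *ᵥ (Q *ᵥ A₀)) ⬝ᵥ S *ᵥ (minOp S Q *ᵥ (Q *ᵥ A₀)))) := by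
  have hTu : IsUnit (Nᵀ * S * N).det := (Matrix.isUnit_iff_isUnit_det _).mp hT.isUnit
  have hW : IsUnit (kkt S Q).det := isUnit_kkt_det_of_kernelBasis e S Q N hQN hNA hQM hTu
  set Astar : ι → ℝ := minOp S Q *ᵥ (Q *ᵥ A₀) with hAstar
  have hker : Q *ᵥ (A₀ - Astar) = 0 := by
    rw [mulVec_sub, hAstar, mulVec_mulVec, mul_minOp S Q hW, one_mulVec, sub_self]
  set z₁ : ρ → ℝ := (Nᵀ * N)⁻¹ *ᵥ (Nᵀ *ᵥ (A₀ - Astar)) with hz₁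
  have hA₀ : A₀ = Astar + N *ᵥ z₁ := by
    rw [hz₁, ← B9Eq3166.kernel_eq_mulVec e Q N hQN hNA hQM hker, add_sub_cancel]
  have hshift : ∀ z : ρ → ℝ, A₀ + N *ᵥ z = Astar + N *ᵥ (z + z₁) := fun z => by
    rw [hA₀, mulVec_add, add_assoc, add_comm (N *ᵥ z₁)]
  have hsplit : ∀ u : ρ → ℝ, (Astar + N *ᵥ u) ⬝ᵥ S *ᵥ (Astar + N *ᵥ u) =
      Astar ⬝ᵥ S *ᵥ Astar + u ⬝ᵥ (Nᵀ * S * N) *ᵥ u := fun u => by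
    rw [hAstar, B9SectECov.action_translation S Q hS hW N hQN (Q *ᵥ A₀) u, B9SectECov.config_quadForm N S u]
  simp_rw [hshift]
  rw [integral_add_right_eq_self (μ := (volume : Measure (ρ → ℝ)))
    (fun u : ρ → ℝ => Real.exp (-(1/2 : ℝ) * ((Astar + N *ᵥ u) ⬝ᵥ S *ᵥ (Astar + N *ᵥ u)))) z₁]
  simp_rw [hsplit, mul_add, Real.exp_add]
  rw [integral_const_mul, Beta.GaussianIntegral.integral_exp_neg_half_quadForm _ hT, mul_comm]

end Helpers

/-! ## §1  THE FRAME: the double constraint (3.110) `QA = B, RD*A = 0` as ONE full-row-rank matrix `S = [Q_b ; τ₀]` -/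

section Frame

variable {n m τ b q σ : Type*}

/-- THE SLICE `τ₀ := NᵀΔD*` (`N` a kernel basis of `Q′`, `Δ = D*D` the site Laplacian, `D` the derivative (3.114)): a
full-row-rank replacement of the rank-deficient second constraint `RD*` of (3.110) — `RD*A = 0 ⟺ τ₀A = 0`
(`R_Dt_mulVec_eq_zero_iff`), because `R = ΔN(NᵀΔ²N)⁻¹NᵀΔ` is the orthogonal projection onto `R = ΔN(Q′)` ((3.20), [g13's]
`B9SectECov.R_eq_kernelBasis`). [cite: Balaban1985BackgroundPropagators, (3.110) p.417, (3.20) p.394] -/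
noncomputable def slice [Fintype n] (Δ : Matrix n n ℝ) (N : Matrix n τ ℝ) (D : Matrix b n ℝ) : Matrix τ b ℝ :=
  Nᵀ * Δ * Dᵀ

/-- THE DOUBLE CONSTRAINT (3.110) *"L^jηQ_j(U)A = B on Λ_j, j = 0,1,…,k, R(U)D\*_U A = 0"* (*"In the future we will write
the first condition in (3.110) as Q(U)A = B"*) as the stacked matrix `S := [Q_b ; τ₀] : (q ⊕ τ) × b` — the hyperplane
(3.110) is `{A : SA = (B, 0)}` (`dcon_mulVec_eq_iff`). [cite: Balaban1985BackgroundPropagators, (3.110) p.417] -/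
noncomputable def dcon [Fintype n] (Δ : Matrix n n ℝ) (N : Matrix n τ ℝ) (D : Matrix b n ℝ) (Qb : Matrix q b ℝ) :
    Matrix (q ⊕ τ) b ℝ :=
  fromRows Qb (slice Δ N D)

/-- `τ₀ · DN = NᵀΔ²N` (the slice sees the gauge modes `Dλ`, `λ ∈ N(Q′)`, through a nonsingular matrix). [folklore] -/
theorem slice_mul_gauge [Fintype n] [Fintype b] (Δ : Matrix n n ℝ) (N : Matrix n τ ℝ) (D : Matrix b n ℝ)
    (hD : Dᵀ * D = Δ) : slice Δ N D * (D * N) = Nᵀ * (Δ * Δ) * N := by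
  rw [slice, ← hD]
  simp only [Matrix.mul_assoc]

/-- `RD*A = 0 ⟺ τ₀A = 0`: (→) `NᵀΔ·R = NᵀΔ` (`R` symmetric and `RΔN = ΔN`, [g13's] `R_transpose`, `R_mul_Δ_mul_kernel`);
(←) `RD* = ΔN(NᵀΔ²N)⁻¹·τ₀` ([g13's] `R_eq_kernelBasis`). [cite: Balaban1985BackgroundPropagators, (3.110) p.417, (3.20)-(3.21) p.394] -/
theorem R_Dt_mulVec_eq_zero_iff [Fintype n] [Fintype m] [Fintype τ] [Fintype b] [DecidableEq n] [DecidableEq m]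
    [DecidableEq τ] (e : n ≃ τ ⊕ m) (Δ : Matrix n n ℝ) (Q : Matrix m n ℝ) (a : ℝ) (hΔ : Δ.IsSymm)
    (hΔ' : IsUnit (B9H163.Δ' Δ Q a)) (N : Matrix n τ ℝ) (hQN : Q * N = 0) (hQM : IsUnit (Q * Qᵀ).det)
    (hTs : IsUnit (Nᵀ * (Δ * Δ) * N).det) (D : Matrix b n ℝ) (A : b → ℝ) :
    B9H163.R Δ Q a *ᵥ (Dᵀ *ᵥ A) = 0 ↔ slice Δ N D *ᵥ A = 0 := by
  have hR := B9SectECov.R_eq_kernelBasis e Δ Q a hΔ hΔ' N hQN hQM hTs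
  constructor
  · intro h
    have hNR : Nᵀ * Δ * B9H163.R Δ Q a = Nᵀ * Δ := by
      have h1 := congrArg Matrix.transpose (B9SectECov.R_mul_Δ_mul_kernel Δ Q a hΔ' N hQN)
      rw [transpose_mul, transpose_mul, B9SectECov.R_transpose Δ Q a hΔ, hΔ.eq] at h1
      exact h1
    have hs : slice Δ N D = Nᵀ * Δ * B9H163.R Δ Q a * Dᵀ := by rw [hNR, slice]
    rw [hs, ← mulVec_mulVec, ← mulVec_mulVec, h, mulVec_zero]
  · intro h
    have hRD : B9H163.R Δ Q a * Dᵀ = Δ * N * (Nᵀ * (Δ * Δ) * N)⁻¹ * slice Δ N D := by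
      rw [hR, slice]
      simp only [Matrix.mul_assoc]
    rw [mulVec_mulVec, hRD, ← mulVec_mulVec, h, mulVec_zero]

/-- THE HYPERPLANE (3.110) IS `{A : SA = (B, 0)}`: `SA = (B, 0) ⟺ Q_bA = B ∧ RD*A = 0`.
[cite: Balaban1985BackgroundPropagators, (3.110) p.417] -/
theorem dcon_mulVec_eq_iff [Fintype n] [Fintype m] [Fintype τ] [Fintype b] [DecidableEq n] [DecidableEq m]
    [DecidableEq τ] (e : n ≃ τ ⊕ m) (Δ : Matrix n n ℝ) (Q : Matrix m n ℝ) (a : ℝ) (hΔ : Δ.IsSymm)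
    (hΔ' : IsUnit (B9H163.Δ' Δ Q a)) (N : Matrix n τ ℝ) (hQN : Q * N = 0) (hQM : IsUnit (Q * Qᵀ).det)
    (hTs : IsUnit (Nᵀ * (Δ * Δ) * N).det) (D : Matrix b n ℝ) (Qb : Matrix q b ℝ) (A : b → ℝ) (B : q → ℝ) :
    dcon Δ N D Qb *ᵥ A = Sum.elim B 0 ↔ Qb *ᵥ A = B ∧ B9H163.R Δ Q a *ᵥ (Dᵀ *ᵥ A) = 0 := by
  rw [R_Dt_mulVec_eq_zero_iff e Δ Q a hΔ hΔ' N hQN hQM hTs D A, dcon, fromRows_mulVec, sumElim_eq_sumElim_iff]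

/-- The kernel of `S`: a configuration `N_S z` in a kernel basis `N_S` of `S` (`SN_S = 0`) has `Q_b(N_Sz) = 0` and
`τ₀(N_Sz) = 0`. [folklore] -/
theorem dcon_kernel [Fintype n] [Fintype b] [Fintype σ] (Δ : Matrix n n ℝ) (N : Matrix n τ ℝ) (D : Matrix b n ℝ)
    (Qb : Matrix q b ℝ) (NS : Matrix b σ ℝ) (hSN : dcon Δ N D Qb * NS = 0) (z : σ → ℝ) :
    Qb *ᵥ (NS *ᵥ z) = 0 ∧ slice Δ N D *ᵥ (NS *ᵥ z) = 0 := by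
  have h : dcon Δ N D Qb *ᵥ (NS *ᵥ z) = 0 := by rw [mulVec_mulVec, hSN, zero_mulVec]
  rw [dcon, fromRows_mulVec, ← sumElim_zero_zero, sumElim_eq_sumElim_iff] at h
  exact h

/-- `S = [Q_b ; τ₀]` HAS FULL ROW RANK (`SSᵀ` nonsingular): `xᵀS = 0`, tested on the gauge modes `DN` (`Q_b·DN = D̄Q′N = 0`
by (3.115), `τ₀·DN = NᵀΔ²N` nonsingular), forces the `τ₀`-component of `x` to vanish, and then `Q_bQ_bᵀ` nonsingular
forces the rest. [cite: Balaban1985BackgroundPropagators, (3.110) p.417, (3.115) p.418] -/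
theorem dcon_gram [Fintype n] [Fintype m] [Fintype τ] [Fintype b] [Fintype q] [DecidableEq τ] [DecidableEq q]
    (Δ : Matrix n n ℝ) (Q : Matrix m n ℝ) (N : Matrix n τ ℝ) (hQN : Q * N = 0)
    (hTs : IsUnit (Nᵀ * (Δ * Δ) * N).det) (D : Matrix b n ℝ) (hD : Dᵀ * D = Δ) (Qb : Matrix q b ℝ)
    (Dbar : Matrix q m ℝ) (h115 : Qb * D = Dbar * Q) (hQbM : IsUnit (Qb * Qbᵀ).det) :
    IsUnit (dcon Δ N D Qb * (dcon Δ N D Qb)ᵀ).det := by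
  have hQW : Qb * (D * N) = 0 := by rw [← Matrix.mul_assoc, h115, Matrix.mul_assoc, hQN, Matrix.mul_zero]
  have hSW : dcon Δ N D Qb * (D * N) = fromRows 0 (Nᵀ * (Δ * Δ) * N) := by
    rw [dcon, fromRows_mul, hQW, slice_mul_gauge Δ N D hD]
  have hinj : Function.Injective (dcon Δ N D Qb).vecMul := by
    intro x₁ x₂ hx
    rw [← sub_eq_zero] at hx ⊢
    rw [← sub_vecMul] at hx
    set x := x₁ - x₂
    have h2 : x ∘ Sum.inr = 0 := by
      have hx' : x ᵥ* (dcon Δ N D Qb * (D * N)) = 0 := by rw [← vecMul_vecMul, hx, zero_vecMul]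
      rw [hSW, vecMul_fromRows, vecMul_zero, zero_add] at hx'
      exact Matrix.eq_zero_of_vecMul_eq_zero hTs.ne_zero hx'
    have h1 : x ∘ Sum.inl = 0 := by
      rw [dcon, vecMul_fromRows, h2, zero_vecMul, add_zero] at hx
      exact B9SectECov.eq_zero_of_constraint hQbM hx
    rw [← Sum.elim_comp_inl_inr x, h1, h2, sumElim_zero_zero]
  have hpd : (dcon Δ N D Qb * (dcon Δ N D Qb)ᵀ).PosDef := by
    simpa only [conjTranspose_eq_transpose_of_trivial] using Matrix.PosDef.mul_conjTranspose_self _ hinj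
  exact (Matrix.isUnit_iff_isUnit_det _).mp hpd.isUnit

end Frame

/-! ## §2  (3.111) and *"the existence of a unique minimum on this hyperplane follows from positive definiteness of the
operator Δ_a. This minimum is denoted by HB. It define a linear operator H."* -/

section Minimum

variable {n m τ b q σ : Type*}

/-- **(3.111)**: on the hyperplane (3.110) the functional (3.109) `½⟨A, KA⟩` equals `½⟨A, Δ_aA⟩ − ½⟨B, aB⟩`,
`Δ_a = K + DRD* + Q*aQ` — `⟨A, DRD*A⟩ = ⟨D*A, R D*A⟩ = 0` when `RD*A = 0`, `a‖QA‖² = a‖B‖²`.  (`K` = the matrix of the bond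
form written `Δ(U)` in (3.109); no symmetry needed.) [cite: Balaban1985BackgroundPropagators, (3.111) p.417] -/
theorem eq_3111 [Fintype n] [Fintype m] [Fintype b] [Fintype q] [DecidableEq n] [DecidableEq m]
    (K : Matrix b b ℝ) (Δ : Matrix n n ℝ) (Q : Matrix m n ℝ) (a : ℝ) (D : Matrix b n ℝ) (Qb : Matrix q b ℝ) (ab : ℝ)
    (A : b → ℝ) (B : q → ℝ) (hB : Qb *ᵥ A = B) (hRA : B9H163.R Δ Q a *ᵥ (Dᵀ *ᵥ A) = 0) :
    A ⬝ᵥ K *ᵥ A = A ⬝ᵥ (K + D * B9H163.R Δ Q a * Dᵀ + ab • (Qbᵀ * Qb)) *ᵥ A - ab * (B ⬝ᵥ B) := by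
  have hz : (D * B9H163.R Δ Q a * Dᵀ) *ᵥ A = 0 := by
    rw [← mulVec_mulVec, ← mulVec_mulVec, hRA, mulVec_zero]
  rw [add_mulVec, add_mulVec, dotProduct_add, dotProduct_add, hz, dotProduct_zero, add_zero, Matrix.smul_mulVec,
    dotProduct_smul, Beta.GaussianIntegral.dotProduct_transpose_mul_self_mulVec, hB, smul_eq_mul, add_sub_cancel_right]

/-- On the gauge-fixed hyperplane `{RD*A = 0}` ALSO `⟨A, G⁻¹A⟩ = ⟨A, Δ_aA⟩`, i.e. `⟨A, G⁻¹A⟩ = ⟨A, KA⟩ + a‖Q_bA‖²`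
(`G⁻¹ = Δ_π + DRD* + Q*aQ` of (3.122): `⟨A, Δ_πA⟩ = ⟨TA, K·TA⟩` and `TA = A − DG′(RD*A) = A`) — the exponent bookkeeping
behind (3.155)/(3.159). [cite: Balaban1985BackgroundPropagators, (3.122) p.420, (3.111) p.417] -/
theorem Ginv_quadForm_gaugeFixed [Fintype n] [Fintype m] [Fintype b] [Fintype q] [DecidableEq n] [DecidableEq m]
    [DecidableEq b] (K : Matrix b b ℝ) (Δ : Matrix n n ℝ) (Q : Matrix m n ℝ) (a : ℝ) (D : Matrix b n ℝ)
    (Qb : Matrix q b ℝ) (ab : ℝ) (A : b → ℝ) (hRA : B9H163.R Δ Q a *ᵥ (Dᵀ *ᵥ A) = 0) :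
    A ⬝ᵥ Ginv K Δ Q a D Qb ab *ᵥ A = A ⬝ᵥ K *ᵥ A + ab * ((Qb *ᵥ A) ⬝ᵥ (Qb *ᵥ A)) := by
  have hT : tOp Δ Q a D *ᵥ A = A := by
    rw [B9SectDFP.tOp_mulVec, hRA, mulVec_zero, mulVec_zero, sub_zero]
  have h22 := B9SectDFP.eq_3122 K Δ Q a D Qb ab A (Qb *ᵥ A) rfl
  rw [add_mulVec, dotProduct_add, B9SectDFP.piOp_quadForm, hT, ← mulVec_mulVec, ← mulVec_mulVec, hRA, mulVec_zero,
    dotProduct_zero, add_zero] at h22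
  linarith

/-- `Δ_a > 0` ⇒ `K` IS POSITIVE DEFINITE ALONG THE HYPERPLANE (3.110): for a kernel basis `N_S` of `S` (`SN_S = 0`, `N_SᵀN_S`
nonsingular) the matrix `N_SᵀKN_S` of `z ↦ ⟨N_Sz, K N_Sz⟩` is positive definite — (3.111) with `B = 0`: `⟨N_Sz, K N_Sz⟩ =
⟨N_Sz, Δ_a N_Sz⟩ > 0` for `z ≠ 0`.  This is the print's *"positive definiteness of the operator Δ_a"* ⇒ *"unique minimum on
this hyperplane"*, and the hypothesis `hT` of every Gaussian integral below. [cite: Balaban1985BackgroundPropagators, (3.111) p.417] -/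
theorem kernelForm_posDef [Fintype n] [Fintype m] [Fintype τ] [Fintype b] [Fintype q] [Fintype σ] [DecidableEq n]
    [DecidableEq m] [DecidableEq τ] [DecidableEq σ] (e : n ≃ τ ⊕ m) (K : Matrix b b ℝ) (hK : Kᵀ = K) (Δ : Matrix n n ℝ)
    (Q : Matrix m n ℝ) (a : ℝ) (hΔ : Δ.IsSymm) (hΔ' : IsUnit (B9H163.Δ' Δ Q a)) (N : Matrix n τ ℝ) (hQN : Q * N = 0)
    (hQM : IsUnit (Q * Qᵀ).det) (hTs : IsUnit (Nᵀ * (Δ * Δ) * N).det) (D : Matrix b n ℝ) (Qb : Matrix q b ℝ) (ab : ℝ)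
    (hΔa : (K + D * B9H163.R Δ Q a * Dᵀ + ab • (Qbᵀ * Qb)).PosDef) (NS : Matrix b σ ℝ)
    (hSN : dcon Δ N D Qb * NS = 0) (hNSA : IsUnit (NSᵀ * NS).det) : (NSᵀ * K * NS).PosDef := by
  refine Matrix.PosDef.of_dotProduct_mulVec_pos ?_ fun z hz => ?_
  · have hsym : (NSᵀ * K * NS)ᵀ = NSᵀ * K * NS := by
      rw [transpose_mul, transpose_mul, transpose_transpose, hK, Matrix.mul_assoc]
    exact Matrix.isHermitian_iff_isSymm.mpr hsym
  · have hker := dcon_kernel Δ N D Qb NS hSN z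
    have hR : B9H163.R Δ Q a *ᵥ (Dᵀ *ᵥ (NS *ᵥ z)) = 0 :=
      (R_Dt_mulVec_eq_zero_iff e Δ Q a hΔ hΔ' N hQN hQM hTs D _).mpr hker.2
    have hne : NS *ᵥ z ≠ 0 := fun h0 => hz (B9SectECov.eq_zero_of_kernelBasis hNSA h0)
    have h3 := eq_3111 K Δ Q a D Qb ab (NS *ᵥ z) 0 hker.1 hR
    rw [dotProduct_zero, mul_zero, sub_zero] at h3
    have h1 := hΔa.dotProduct_mulVec_pos hne
    rw [star_trivial, ← h3, B9SectECov.config_quadForm NS K z] at h1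
    rwa [star_trivial]

/-- THE BORDERED (KKT) MATRIX `[[K, Sᵀ],[S, 0]]` OF (3.109)–(3.110) IS NONSINGULAR under `Δ_a > 0` — [an2's]
`isUnit_kkt_det_of_kernelBasis` fed with `dcon_gram` (full row rank of `S`) and `kernelForm_posDef`; this is the
finite-dimensional content of *"The variational problem (3.109), (3.110) has a unique solution."*
[cite: Balaban1985BackgroundPropagators, (3.109)-(3.111) p.417] -/
theorem isUnit_kkt_dcon [Fintype n] [Fintype m] [Fintype τ] [Fintype b] [Fintype q] [Fintype σ] [DecidableEq n]
    [DecidableEq m] [DecidableEq τ] [DecidableEq b] [DecidableEq q] [DecidableEq σ] (eS : b ≃ σ ⊕ (q ⊕ τ))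
    (e : n ≃ τ ⊕ m) (K : Matrix b b ℝ) (hK : Kᵀ = K) (Δ : Matrix n n ℝ) (Q : Matrix m n ℝ) (a : ℝ) (hΔ : Δ.IsSymm)
    (hΔ' : IsUnit (B9H163.Δ' Δ Q a)) (N : Matrix n τ ℝ) (hQN : Q * N = 0) (hQM : IsUnit (Q * Qᵀ).det)
    (hTs : IsUnit (Nᵀ * (Δ * Δ) * N).det) (D : Matrix b n ℝ) (hD : Dᵀ * D = Δ) (Qb : Matrix q b ℝ)
    (Dbar : Matrix q m ℝ) (h115 : Qb * D = Dbar * Q) (ab : ℝ) (hQbM : IsUnit (Qb * Qbᵀ).det)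
    (hΔa : (K + D * B9H163.R Δ Q a * Dᵀ + ab • (Qbᵀ * Qb)).PosDef) (NS : Matrix b σ ℝ)
    (hSN : dcon Δ N D Qb * NS = 0) (hNSA : IsUnit (NSᵀ * NS).det) : IsUnit (kkt K (dcon Δ N D Qb)).det :=
  isUnit_kkt_det_of_kernelBasis eS K (dcon Δ N D Qb) NS hSN hNSA (dcon_gram Δ Q N hQN hTs D hD Qb Dbar h115 hQbM)
    ((Matrix.isUnit_iff_isUnit_det _).mp
      (kernelForm_posDef e K hK Δ Q a hΔ hΔ' N hQN hQM hTs D Qb ab hΔa NS hSN hNSA).isUnit)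

/-- **THE OPERATOR `H` OF (3.111)** (*"This minimum is denoted by HB. It define a linear operator H."*): the `B`-column
block of [an2's] constrained-minimiser block `ℋ = minOp K S` of the bordered inverse, `HB := ℋ(B, 0)` (`hOp_mulVec`) — the
critical point of `½⟨A, KA⟩` on `{SA = (B, 0)}` = the hyperplane (3.110); under `Δ_a > 0` it is the unique minimiser
(`eq_3109_min`). [cite: Balaban1985BackgroundPropagators, (3.111) p.417] -/
noncomputable def hOp [Fintype n] [Fintype τ] [Fintype b] [Fintype q] [DecidableEq τ] [DecidableEq b] [DecidableEq q]
    (K : Matrix b b ℝ) (Δ : Matrix n n ℝ) (N : Matrix n τ ℝ) (D : Matrix b n ℝ) (Qb : Matrix q b ℝ) : Matrix b q ℝ :=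
  (minOp K (dcon Δ N D Qb)).toCols₁

/-- `HB = ℋ(B, 0)`. [cite: Balaban1985BackgroundPropagators, (3.111) p.417] -/
theorem hOp_mulVec [Fintype n] [Fintype τ] [Fintype b] [Fintype q] [DecidableEq τ] [DecidableEq b] [DecidableEq q]
    (K : Matrix b b ℝ) (Δ : Matrix n n ℝ) (N : Matrix n τ ℝ) (D : Matrix b n ℝ) (Qb : Matrix q b ℝ) (B : q → ℝ) :
    hOp K Δ N D Qb *ᵥ B = minOp K (dcon Δ N D Qb) *ᵥ Sum.elim B 0 := by
  conv_rhs => rw [← fromCols_toCols (minOp K (dcon Δ N D Qb)), fromCols_mulVec_sumElim, mulVec_zero, add_zero]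
  rfl

/-- `HB` LIES ON THE HYPERPLANE (3.110): `S(HB) = (B, 0)` ([an2's] `Sℋ = 1`). [cite: Balaban1985BackgroundPropagators, (3.110) p.417] -/
theorem dcon_hOp_mulVec [Fintype n] [Fintype τ] [Fintype b] [Fintype q] [DecidableEq τ] [DecidableEq b]
    [DecidableEq q] (K : Matrix b b ℝ) (Δ : Matrix n n ℝ) (N : Matrix n τ ℝ) (D : Matrix b n ℝ) (Qb : Matrix q b ℝ)
    (hW : IsUnit (kkt K (dcon Δ N D Qb)).det) (B : q → ℝ) :
    dcon Δ N D Qb *ᵥ (hOp K Δ N D Qb *ᵥ B) = Sum.elim B 0 := by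
  rw [hOp_mulVec, mulVec_mulVec, mul_minOp _ _ hW, one_mulVec]

/-- … i.e. `Q_b(HB) = B` and `RD*(HB) = 0`. [cite: Balaban1985BackgroundPropagators, (3.110) p.417] -/
theorem hOp_feasible [Fintype n] [Fintype m] [Fintype τ] [Fintype b] [Fintype q] [DecidableEq n] [DecidableEq m]
    [DecidableEq τ] [DecidableEq b] [DecidableEq q] (e : n ≃ τ ⊕ m) (K : Matrix b b ℝ) (Δ : Matrix n n ℝ)
    (Q : Matrix m n ℝ) (a : ℝ) (hΔ : Δ.IsSymm) (hΔ' : IsUnit (B9H163.Δ' Δ Q a)) (N : Matrix n τ ℝ)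
    (hQN : Q * N = 0) (hQM : IsUnit (Q * Qᵀ).det) (hTs : IsUnit (Nᵀ * (Δ * Δ) * N).det) (D : Matrix b n ℝ)
    (Qb : Matrix q b ℝ) (hW : IsUnit (kkt K (dcon Δ N D Qb)).det) (B : q → ℝ) :
    Qb *ᵥ (hOp K Δ N D Qb *ᵥ B) = B ∧ B9H163.R Δ Q a *ᵥ (Dᵀ *ᵥ (hOp K Δ N D Qb *ᵥ B)) = 0 :=
  (dcon_mulVec_eq_iff e Δ Q a hΔ hΔ' N hQN hQM hTs D Qb _ B).mp (dcon_hOp_mulVec K Δ N D Qb hW B)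

/-- **(3.109) SPLITS ON THE HYPERPLANE (3.110)**: for every `A` with `SA = (B, 0)`,
`⟨A, KA⟩ = ⟨HB, K·HB⟩ + ⟨A − HB, K(A − HB)⟩` — `A − HB ∈ ker S = Ran N_S` and the cross term vanishes ([g13's]
`B9SectECov.action_translation`, [g14's] `B9Eq3166.kernel_eq_mulVec`); this is the print's *"making the translation
A = A′ + HB and then noticing that the term with A′ vanishes"*. [cite: Balaban1985BackgroundPropagators, (3.109)-(3.112) p.417] -/
theorem eq_3109_split [Fintype n] [Fintype τ] [Fintype b] [Fintype q] [Fintype σ] [DecidableEq τ] [DecidableEq b]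
    [DecidableEq q] [DecidableEq σ] (eS : b ≃ σ ⊕ (q ⊕ τ)) (K : Matrix b b ℝ) (hK : Kᵀ = K) (Δ : Matrix n n ℝ)
    (N : Matrix n τ ℝ) (D : Matrix b n ℝ) (Qb : Matrix q b ℝ) (hW : IsUnit (kkt K (dcon Δ N D Qb)).det)
    (NS : Matrix b σ ℝ) (hSN : dcon Δ N D Qb * NS = 0) (hNSA : IsUnit (NSᵀ * NS).det)
    (hSM : IsUnit (dcon Δ N D Qb * (dcon Δ N D Qb)ᵀ).det) (A : b → ℝ) (B : q → ℝ)
    (hA : dcon Δ N D Qb *ᵥ A = Sum.elim B 0) :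
    A ⬝ᵥ K *ᵥ A = (hOp K Δ N D Qb *ᵥ B) ⬝ᵥ K *ᵥ (hOp K Δ N D Qb *ᵥ B) +
      (A - hOp K Δ N D Qb *ᵥ B) ⬝ᵥ K *ᵥ (A - hOp K Δ N D Qb *ᵥ B) := by
  have hker : dcon Δ N D Qb *ᵥ (A - hOp K Δ N D Qb *ᵥ B) = 0 := by
    rw [mulVec_sub, hA, dcon_hOp_mulVec K Δ N D Qb hW B, sub_self]
  have hz := B9Eq3166.kernel_eq_mulVec eS (dcon Δ N D Qb) NS hSN hNSA hSM hker
  set z₁ : σ → ℝ := (NSᵀ * NS)⁻¹ *ᵥ (NSᵀ *ᵥ (A - hOp K Δ N D Qb *ᵥ B))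
  have hA' : A = hOp K Δ N D Qb *ᵥ B + NS *ᵥ z₁ := by rw [← hz, add_sub_cancel]
  conv_lhs => rw [hA']
  rw [hz, hOp_mulVec, B9SectECov.action_translation K (dcon Δ N D Qb) hK hW NS hSN (Sum.elim B 0) z₁]

/-- **`HB` IS THE UNIQUE MINIMUM OF (3.109) ON (3.110)** (*"hence the existence of a unique minimum on this hyperplane
follows from positive definiteness of the operator Δ_a"*): `⟨HB, K·HB⟩ ≤ ⟨A, KA⟩` for every `A` on the hyperplane, with
equality only at `A = HB`. [cite: Balaban1985BackgroundPropagators, (3.111) p.417] -/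
theorem eq_3109_min [Fintype n] [Fintype m] [Fintype τ] [Fintype b] [Fintype q] [Fintype σ] [DecidableEq n]
    [DecidableEq m] [DecidableEq τ] [DecidableEq b] [DecidableEq q] [DecidableEq σ] (eS : b ≃ σ ⊕ (q ⊕ τ))
    (e : n ≃ τ ⊕ m) (K : Matrix b b ℝ) (hK : Kᵀ = K) (Δ : Matrix n n ℝ) (Q : Matrix m n ℝ) (a : ℝ) (hΔ : Δ.IsSymm)
    (hΔ' : IsUnit (B9H163.Δ' Δ Q a)) (N : Matrix n τ ℝ) (hQN : Q * N = 0) (hQM : IsUnit (Q * Qᵀ).det)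
    (hTs : IsUnit (Nᵀ * (Δ * Δ) * N).det) (D : Matrix b n ℝ) (hD : Dᵀ * D = Δ) (Qb : Matrix q b ℝ)
    (Dbar : Matrix q m ℝ) (h115 : Qb * D = Dbar * Q) (ab : ℝ) (hQbM : IsUnit (Qb * Qbᵀ).det)
    (hΔa : (K + D * B9H163.R Δ Q a * Dᵀ + ab • (Qbᵀ * Qb)).PosDef) (NS : Matrix b σ ℝ)
    (hSN : dcon Δ N D Qb * NS = 0) (hNSA : IsUnit (NSᵀ * NS).det) (A : b → ℝ) (B : q → ℝ)
    (hA : dcon Δ N D Qb *ᵥ A = Sum.elim B 0) :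
    (hOp K Δ N D Qb *ᵥ B) ⬝ᵥ K *ᵥ (hOp K Δ N D Qb *ᵥ B) ≤ A ⬝ᵥ K *ᵥ A ∧
    (A ⬝ᵥ K *ᵥ A ≤ (hOp K Δ N D Qb *ᵥ B) ⬝ᵥ K *ᵥ (hOp K Δ N D Qb *ᵥ B) → A = hOp K Δ N D Qb *ᵥ B) := by
  have hT := kernelForm_posDef e K hK Δ Q a hΔ hΔ' N hQN hQM hTs D Qb ab hΔa NS hSN hNSA
  have hSM := dcon_gram Δ Q N hQN hTs D hD Qb Dbar h115 hQbM
  have hW := isUnit_kkt_dcon eS e K hK Δ Q a hΔ hΔ' N hQN hQM hTs D hD Qb Dbar h115 ab hQbM hΔa NS hSN hNSA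
  have hsplit := eq_3109_split eS K hK Δ N D Qb hW NS hSN hNSA hSM A B hA
  have hker : dcon Δ N D Qb *ᵥ (A - hOp K Δ N D Qb *ᵥ B) = 0 := by
    rw [mulVec_sub, hA, dcon_hOp_mulVec K Δ N D Qb hW B, sub_self]
  have hz := B9Eq3166.kernel_eq_mulVec eS (dcon Δ N D Qb) NS hSN hNSA hSM hker
  set z₁ : σ → ℝ := (NSᵀ * NS)⁻¹ *ᵥ (NSᵀ *ᵥ (A - hOp K Δ N D Qb *ᵥ B))
  have hq : (A - hOp K Δ N D Qb *ᵥ B) ⬝ᵥ K *ᵥ (A - hOp K Δ N D Qb *ᵥ B) = z₁ ⬝ᵥ (NSᵀ * K * NS) *ᵥ z₁ := by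
    rw [hz, B9SectECov.config_quadForm]
  have hnn : 0 ≤ z₁ ⬝ᵥ (NSᵀ * K * NS) *ᵥ z₁ := by
    simpa only [star_trivial] using hT.posSemidef.dotProduct_mulVec_nonneg z₁
  refine ⟨by linarith, fun hle => ?_⟩
  have hz0 : z₁ = 0 := by
    by_contra hne
    have hpos := hT.dotProduct_mulVec_pos hne
    rw [star_trivial] at hpos
    linarith
  rw [← sub_eq_zero, hz, hz0, mulVec_zero]

end Minimum

/-! ## §3  (3.112): *"HB = Z⁻¹(B)∫dA δ(QA − B)δ_R(RD\*A)e^{−½⟨A,ΔA⟩}A, where Z(B) is given by the same integral with the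
last A replaced by 1"* — AT MEASURE LEVEL over a kernel-basis parametrisation `A = A₀ + N_Sz` of the double fibre -/

section Mean

variable {n m τ b q σ : Type*}

/-- **(3.112) AT MEASURE LEVEL.** For a point `A₀` of the double fibre `{Q_bA = B, RD*A = 0}` (`B := Q_bA₀`) and a
kernel basis `N_S` of `S = [Q_b ; τ₀]`, the `δ(QA − B)δ_R(RD*A)`-Gaussian mean of `A` over the fibre, computed as a
genuine Lebesgue integral `∫dz` over `A = A₀ + N_Sz`, IS `HB`:
`∫dz e^{−½⟨A,KA⟩}·A = Z(B)·HB`, `Z(B) = ∫dz e^{−½⟨A,KA⟩}` — [g14's] `B9SectDFP.constrainedMean` at `(K, S)`, i.e. the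
print's *"translation A = A′ + HB … the term with A′ vanishes, and the coefficient at HB cancels with Z⁻¹(B)"*;
convergence = `kernelForm_posDef` (*"we can use again the positive definiteness of Δ_a"*).  The constant Jacobian of
the parametrisation (and the `δ_R` normalisation (3.17)) cancels between numerator and `Z(B)` and is not tracked.
[cite: Balaban1985BackgroundPropagators, (3.112) p.417] -/
theorem eq_3112 [Fintype n] [Fintype m] [Fintype τ] [Fintype b] [Fintype q] [Fintype σ] [DecidableEq n]
    [DecidableEq m] [DecidableEq τ] [DecidableEq b] [DecidableEq q] [DecidableEq σ] (eS : b ≃ σ ⊕ (q ⊕ τ))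
    (e : n ≃ τ ⊕ m) (K : Matrix b b ℝ) (hK : Kᵀ = K) (Δ : Matrix n n ℝ) (Q : Matrix m n ℝ) (a : ℝ) (hΔ : Δ.IsSymm)
    (hΔ' : IsUnit (B9H163.Δ' Δ Q a)) (N : Matrix n τ ℝ) (hQN : Q * N = 0) (hQM : IsUnit (Q * Qᵀ).det)
    (hTs : IsUnit (Nᵀ * (Δ * Δ) * N).det) (D : Matrix b n ℝ) (hD : Dᵀ * D = Δ) (Qb : Matrix q b ℝ)
    (Dbar : Matrix q m ℝ) (h115 : Qb * D = Dbar * Q) (ab : ℝ) (hQbM : IsUnit (Qb * Qbᵀ).det)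
    (hΔa : (K + D * B9H163.R Δ Q a * Dᵀ + ab • (Qbᵀ * Qb)).PosDef) (NS : Matrix b σ ℝ)
    (hSN : dcon Δ N D Qb * NS = 0) (hNSA : IsUnit (NSᵀ * NS).det) (A₀ : b → ℝ)
    (hA₀ : B9H163.R Δ Q a *ᵥ (Dᵀ *ᵥ A₀) = 0) :
    ∫ z : σ → ℝ, Real.exp (-(1/2 : ℝ) * ((A₀ + NS *ᵥ z) ⬝ᵥ K *ᵥ (A₀ + NS *ᵥ z))) • (A₀ + NS *ᵥ z) =
      (∫ z : σ → ℝ, Real.exp (-(1/2 : ℝ) * ((A₀ + NS *ᵥ z) ⬝ᵥ K *ᵥ (A₀ + NS *ᵥ z)))) •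
        (hOp K Δ N D Qb *ᵥ (Qb *ᵥ A₀)) := by
  have hT := kernelForm_posDef e K hK Δ Q a hΔ hΔ' N hQN hQM hTs D Qb ab hΔa NS hSN hNSA
  have hSM := dcon_gram Δ Q N hQN hTs D hD Qb Dbar h115 hQbM
  have hS0 : dcon Δ N D Qb *ᵥ A₀ = Sum.elim (Qb *ᵥ A₀) 0 :=
    (dcon_mulVec_eq_iff e Δ Q a hΔ hΔ' N hQN hQM hTs D Qb A₀ (Qb *ᵥ A₀)).mpr ⟨rfl, hA₀⟩
  rw [B9SectDFP.constrainedMean eS K hK (dcon Δ N D Qb) NS hSN hNSA hSM hT A₀, hS0, hOp_mulVec]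

/-- **`Z(B)` IN CLOSED FORM**: `Z(B) = ∫dz e^{−½⟨A₀ + N_Sz, K(A₀ + N_Sz)⟩} = (√2π)^{dim}/√det(N_SᵀKN_S) · e^{−½⟨HB, K·HB⟩}`,
`B = Q_bA₀` — the prefactor does NOT depend on `B` (this is what makes the `Z_k⁻¹` of (3.159) a constant).
[cite: Balaban1985BackgroundPropagators, (3.112) p.417, (3.159) p.428] -/
theorem Z_eq [Fintype n] [Fintype m] [Fintype τ] [Fintype b] [Fintype q] [Fintype σ] [DecidableEq n]
    [DecidableEq m] [DecidableEq τ] [DecidableEq b] [DecidableEq q] [DecidableEq σ] (eS : b ≃ σ ⊕ (q ⊕ τ))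
    (e : n ≃ τ ⊕ m) (K : Matrix b b ℝ) (hK : Kᵀ = K) (Δ : Matrix n n ℝ) (Q : Matrix m n ℝ) (a : ℝ) (hΔ : Δ.IsSymm)
    (hΔ' : IsUnit (B9H163.Δ' Δ Q a)) (N : Matrix n τ ℝ) (hQN : Q * N = 0) (hQM : IsUnit (Q * Qᵀ).det)
    (hTs : IsUnit (Nᵀ * (Δ * Δ) * N).det) (D : Matrix b n ℝ) (hD : Dᵀ * D = Δ) (Qb : Matrix q b ℝ)
    (Dbar : Matrix q m ℝ) (h115 : Qb * D = Dbar * Q) (ab : ℝ) (hQbM : IsUnit (Qb * Qbᵀ).det)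
    (hΔa : (K + D * B9H163.R Δ Q a * Dᵀ + ab • (Qbᵀ * Qb)).PosDef) (NS : Matrix b σ ℝ)
    (hSN : dcon Δ N D Qb * NS = 0) (hNSA : IsUnit (NSᵀ * NS).det) (A₀ : b → ℝ)
    (hA₀ : B9H163.R Δ Q a *ᵥ (Dᵀ *ᵥ A₀) = 0) :
    ∫ z : σ → ℝ, Real.exp (-(1/2 : ℝ) * ((A₀ + NS *ᵥ z) ⬝ᵥ K *ᵥ (A₀ + NS *ᵥ z))) =
      (Real.sqrt (2 * π) ^ Fintype.card σ / Real.sqrt (NSᵀ * K * NS).det) *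
        Real.exp (-(1/2 : ℝ) * ((hOp K Δ N D Qb *ᵥ (Qb *ᵥ A₀)) ⬝ᵥ K *ᵥ (hOp K Δ N D Qb *ᵥ (Qb *ᵥ A₀)))) := by
  have hT := kernelForm_posDef e K hK Δ Q a hΔ hΔ' N hQN hQM hTs D Qb ab hΔa NS hSN hNSA
  have hSM := dcon_gram Δ Q N hQN hTs D hD Qb Dbar h115 hQbM
  have hS0 : dcon Δ N D Qb *ᵥ A₀ = Sum.elim (Qb *ᵥ A₀) 0 :=
    (dcon_mulVec_eq_iff e Δ Q a hΔ hΔ' N hQN hQM hTs D Qb A₀ (Qb *ᵥ A₀)).mpr ⟨rfl, hA₀⟩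
  rw [fibreGaussian eS K hK (dcon Δ N D Qb) NS hSN hNSA hSM hT A₀, hS0, hOp_mulVec]

/-- `Z(B) > 0`. [cite: Balaban1985BackgroundPropagators, (3.112) p.417] -/
theorem Z_pos [Fintype n] [Fintype m] [Fintype τ] [Fintype b] [Fintype q] [Fintype σ] [DecidableEq n]
    [DecidableEq m] [DecidableEq τ] [DecidableEq b] [DecidableEq q] [DecidableEq σ] (eS : b ≃ σ ⊕ (q ⊕ τ))
    (e : n ≃ τ ⊕ m) (K : Matrix b b ℝ) (hK : Kᵀ = K) (Δ : Matrix n n ℝ) (Q : Matrix m n ℝ) (a : ℝ) (hΔ : Δ.IsSymm)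
    (hΔ' : IsUnit (B9H163.Δ' Δ Q a)) (N : Matrix n τ ℝ) (hQN : Q * N = 0) (hQM : IsUnit (Q * Qᵀ).det)
    (hTs : IsUnit (Nᵀ * (Δ * Δ) * N).det) (D : Matrix b n ℝ) (hD : Dᵀ * D = Δ) (Qb : Matrix q b ℝ)
    (Dbar : Matrix q m ℝ) (h115 : Qb * D = Dbar * Q) (ab : ℝ) (hQbM : IsUnit (Qb * Qbᵀ).det)
    (hΔa : (K + D * B9H163.R Δ Q a * Dᵀ + ab • (Qbᵀ * Qb)).PosDef) (NS : Matrix b σ ℝ)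
    (hSN : dcon Δ N D Qb * NS = 0) (hNSA : IsUnit (NSᵀ * NS).det) (A₀ : b → ℝ)
    (hA₀ : B9H163.R Δ Q a *ᵥ (Dᵀ *ᵥ A₀) = 0) :
    0 < ∫ z : σ → ℝ, Real.exp (-(1/2 : ℝ) * ((A₀ + NS *ᵥ z) ⬝ᵥ K *ᵥ (A₀ + NS *ᵥ z))) := by
  rw [Z_eq eS e K hK Δ Q a hΔ hΔ' N hQN hQM hTs D hD Qb Dbar h115 ab hQbM hΔa NS hSN hNSA A₀ hA₀]
  exact mul_pos (B9SectECov.gaussNorm_pos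
    (kernelForm_posDef e K hK Δ Q a hΔ hΔ' N hQN hQM hTs D Qb ab hΔa NS hSN hNSA)) (Real.exp_pos _)

/-- **(3.112) IN THE PRINT'S NORMALISED FORM** `HB = Z⁻¹(B)·∫ δ(QA − B)δ_R(RD*A) e^{−½⟨A,ΔA⟩} A`.
[cite: Balaban1985BackgroundPropagators, (3.112) p.417] -/
theorem eq_3112_normalised [Fintype n] [Fintype m] [Fintype τ] [Fintype b] [Fintype q] [Fintype σ] [DecidableEq n]
    [DecidableEq m] [DecidableEq τ] [DecidableEq b] [DecidableEq q] [DecidableEq σ] (eS : b ≃ σ ⊕ (q ⊕ τ))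
    (e : n ≃ τ ⊕ m) (K : Matrix b b ℝ) (hK : Kᵀ = K) (Δ : Matrix n n ℝ) (Q : Matrix m n ℝ) (a : ℝ) (hΔ : Δ.IsSymm)
    (hΔ' : IsUnit (B9H163.Δ' Δ Q a)) (N : Matrix n τ ℝ) (hQN : Q * N = 0) (hQM : IsUnit (Q * Qᵀ).det)
    (hTs : IsUnit (Nᵀ * (Δ * Δ) * N).det) (D : Matrix b n ℝ) (hD : Dᵀ * D = Δ) (Qb : Matrix q b ℝ)
    (Dbar : Matrix q m ℝ) (h115 : Qb * D = Dbar * Q) (ab : ℝ) (hQbM : IsUnit (Qb * Qbᵀ).det)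
    (hΔa : (K + D * B9H163.R Δ Q a * Dᵀ + ab • (Qbᵀ * Qb)).PosDef) (NS : Matrix b σ ℝ)
    (hSN : dcon Δ N D Qb * NS = 0) (hNSA : IsUnit (NSᵀ * NS).det) (A₀ : b → ℝ)
    (hA₀ : B9H163.R Δ Q a *ᵥ (Dᵀ *ᵥ A₀) = 0) :
    hOp K Δ N D Qb *ᵥ (Qb *ᵥ A₀) =
      (∫ z : σ → ℝ, Real.exp (-(1/2 : ℝ) * ((A₀ + NS *ᵥ z) ⬝ᵥ K *ᵥ (A₀ + NS *ᵥ z))))⁻¹ •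
        ∫ z : σ → ℝ, Real.exp (-(1/2 : ℝ) * ((A₀ + NS *ᵥ z) ⬝ᵥ K *ᵥ (A₀ + NS *ᵥ z))) • (A₀ + NS *ᵥ z) := by
  rw [eq_3112 eS e K hK Δ Q a hΔ hΔ' N hQN hQM hTs D hD Qb Dbar h115 ab hQbM hΔa NS hSN hNSA A₀ hA₀, smul_smul,
    inv_mul_cancel₀ (Z_pos eS e K hK Δ Q a hΔ hΔ' N hQN hQM hTs D hD Qb Dbar h115 ab hQbM hΔa NS hSN hNSA A₀ hA₀).ne',
    one_smul]

end Mean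

/-! ## §4  END-TO-END: the minimiser `H` of (3.109)–(3.110) IS the propagator formula (3.126) `HB = GQ*(QGQ*)⁻¹B` —
by KKT uniqueness, WITHOUT the Faddeev–Popov route (3.118)–(3.125) -/

section Propagator

variable {n m τ b q σ : Type*}

/-- **(3.109)–(3.110) ⟹ (3.126) DIRECTLY.**  Let `x := G Q_bᵀ(Q_bGQ_bᵀ)⁻¹B`, `G⁻¹ = Δ_π + DRD* + Q*aQ` ((3.122), nonsingular,
`Q_bGQ_bᵀ` nonsingular).  Then `x` is on the hyperplane (3.110) — `Q_bx = B` ([g14's] `lagrange_3123`), `RD*x = 0`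
((3.124)) — and its `K`-gradient is a combination of constraint rows: `G⁻¹x = Q_bᵀω` with `G⁻¹x = Tᵀ(Kx) + aQ_bᵀB`
(`Tx = x`), `Tᵀ = 1 − DRG′D*`, `DR = τ₀ᵀ·(NᵀΔ²N)⁻¹NᵀΔ`, so `Kx = Q_bᵀ(ω − aB) + τ₀ᵀu = Sᵀ(ω − aB, u)`.  KKT uniqueness
for the nonsingular bordered matrix of `(K, S)` (`eq_minOp_of_kkt`) gives `x = ℋ(Sx) = ℋ(B, 0) = HB`.  No Gaussian
integral, no (3.118)–(3.121), no (3.125) is used. [cite: Balaban1985BackgroundPropagators, (3.126) p.420, (3.109)-(3.111) p.417] -/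
theorem hOp_mulVec_eq_3126 [Fintype n] [Fintype m] [Fintype τ] [Fintype b] [Fintype q] [DecidableEq n]
    [DecidableEq m] [DecidableEq τ] [DecidableEq b] [DecidableEq q] (e : n ≃ τ ⊕ m) (K : Matrix b b ℝ)
    (Δ : Matrix n n ℝ) (Q : Matrix m n ℝ) (a : ℝ) (hΔ : Δ.IsSymm) (hΔ' : IsUnit (B9H163.Δ' Δ Q a)) (N : Matrix n τ ℝ)
    (hQN : Q * N = 0) (hQM : IsUnit (Q * Qᵀ).det) (hTs : IsUnit (Nᵀ * (Δ * Δ) * N).det) (D : Matrix b n ℝ)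
    (hD : Dᵀ * D = Δ) (Qb : Matrix q b ℝ) (Dbar : Matrix q m ℝ) (h115 : Qb * D = Dbar * Q) (ab : ℝ)
    (hW : IsUnit (kkt K (dcon Δ N D Qb)).det) (hG : IsUnit (Ginv K Δ Q a D Qb ab).det)
    (hP : IsUnit (Qb * (Ginv K Δ Q a D Qb ab)⁻¹ * Qbᵀ).det) (B : q → ℝ) :
    hOp K Δ N D Qb *ᵥ B = minOp (Ginv K Δ Q a D Qb ab) Qb *ᵥ B ∧
    hOp K Δ N D Qb *ᵥ B =
      (Ginv K Δ Q a D Qb ab)⁻¹ *ᵥ (Qbᵀ *ᵥ ((Qb * (Ginv K Δ Q a D Qb ab)⁻¹ * Qbᵀ)⁻¹ *ᵥ B)) := by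
  obtain ⟨hTx, h26⟩ := B9SectDFP.eq_3126 e K Δ Q a hΔ hΔ' N hQN hQM hTs D hD Qb Dbar h115 ab hG hP B
  obtain ⟨hEL, hQx, -⟩ := B9SectDFP.lagrange_3123 (Ginv K Δ Q a D Qb ab) Qb hG hP B
  have h24 := (B9SectDFP.eq_3124 e K Δ Q a hΔ hΔ' N hQN hQM hTs D hD Qb Dbar h115 ab hG).1
  have hR := B9SectECov.R_eq_kernelBasis e Δ Q a hΔ hΔ' N hQN hQM hTs
  set x : b → ℝ := minOp (Ginv K Δ Q a D Qb ab) Qb *ᵥ B with hx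
  rw [← h26] at hEL hQx
  -- `x` is on the hyperplane (3.110)
  have hRx : B9H163.R Δ Q a *ᵥ (Dᵀ *ᵥ x) = 0 := by
    rw [h26, mulVec_mulVec, mulVec_mulVec, mulVec_mulVec, h24, zero_mulVec]
  have hSx : dcon Δ N D Qb *ᵥ x = Sum.elim B 0 :=
    (dcon_mulVec_eq_iff e Δ Q a hΔ hΔ' N hQN hQM hTs D Qb x B).mpr ⟨hQx, hRx⟩
  -- `Kx ∈ Ran Sᵀ`
  have h1 : piOp K Δ Q a D *ᵥ x = (tOp Δ Q a D)ᵀ *ᵥ (K *ᵥ x) := by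
    rw [B9SectDFP.piOp, ← mulVec_mulVec, ← mulVec_mulVec, hTx]
  have h2 : (D * B9H163.R Δ Q a * Dᵀ) *ᵥ x = 0 := by
    rw [← mulVec_mulVec, ← mulVec_mulVec, hRx, mulVec_zero]
  have h3 : (ab • (Qbᵀ * Qb)) *ᵥ x = Qbᵀ *ᵥ (ab • B) := by
    rw [Matrix.smul_mulVec, ← mulVec_mulVec, hQx, mulVec_smul]
  have hGx : Ginv K Δ Q a D Qb ab *ᵥ x = (tOp Δ Q a D)ᵀ *ᵥ (K *ᵥ x) + Qbᵀ *ᵥ (ab • B) := by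
    rw [B9SectDFP.Ginv, add_mulVec, add_mulVec, h1, h2, h3, add_zero]
  have hTt : (tOp Δ Q a D)ᵀ = 1 - D * (B9H163.R Δ Q a * (B9H163.G' Δ Q a * Dᵀ)) := by
    rw [B9SectDFP.tOp, transpose_sub, transpose_one, transpose_mul, transpose_mul, transpose_mul,
      transpose_transpose, B9SectECov.R_transpose Δ Q a hΔ, (B9H163.G'_isSymm (Q := Q) (a := a) hΔ).eq]
  have hDR : D * B9H163.R Δ Q a = (slice Δ N D)ᵀ * ((Nᵀ * (Δ * Δ) * N)⁻¹ * Nᵀ * Δ) := by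
    rw [hR, slice, transpose_mul, transpose_mul, transpose_transpose, transpose_transpose, hΔ.eq]
    simp only [Matrix.mul_assoc]
  have hDR' : D * (B9H163.R Δ Q a * (B9H163.G' Δ Q a * Dᵀ)) =
      (slice Δ N D)ᵀ * ((Nᵀ * (Δ * Δ) * N)⁻¹ * Nᵀ * Δ * (B9H163.G' Δ Q a * Dᵀ)) := by
    rw [← Matrix.mul_assoc, hDR, Matrix.mul_assoc]
  have h4 : (tOp Δ Q a D)ᵀ *ᵥ (K *ᵥ x) =
      K *ᵥ x - ((slice Δ N D)ᵀ * ((Nᵀ * (Δ * Δ) * N)⁻¹ * Nᵀ * Δ * (B9H163.G' Δ Q a * Dᵀ))) *ᵥ (K *ᵥ x) := by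
    rw [hTt, sub_mulVec, one_mulVec, hDR']
  have h5 : (tOp Δ Q a D)ᵀ *ᵥ (K *ᵥ x) =
      Qbᵀ *ᵥ ((Qb * (Ginv K Δ Q a D Qb ab)⁻¹ * Qbᵀ)⁻¹ *ᵥ B) - Qbᵀ *ᵥ (ab • B) := by
    rw [eq_sub_iff_add_eq, ← hGx, hEL]
  have hy : K *ᵥ x = (dcon Δ N D Qb)ᵀ *ᵥ
      Sum.elim ((Qb * (Ginv K Δ Q a D Qb ab)⁻¹ * Qbᵀ)⁻¹ *ᵥ B - ab • B)
        (((Nᵀ * (Δ * Δ) * N)⁻¹ * Nᵀ * Δ) *ᵥ (B9H163.G' Δ Q a *ᵥ (Dᵀ *ᵥ (K *ᵥ x)))) := by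
    rw [dcon, transpose_fromRows, fromCols_mulVec_sumElim, mulVec_sub, ← h5, h4]
    simp only [mulVec_mulVec, Matrix.mul_assoc, sub_add_cancel]
  -- KKT uniqueness
  have hx' := eq_minOp_of_kkt K (dcon Δ N D Qb) hW x _ hy
  rw [hSx, ← hOp_mulVec] at hx'
  exact ⟨hx'.symm, hx'.symm.trans h26⟩

/-- **THE OPERATOR IDENTITY `H = GQ*(QGQ*)⁻¹` FROM `Δ_a > 0` ALONE** ((3.111) ⟹ (3.126)): all nonsingularity
hypotheses of `hOp_mulVec_eq_3126` DISCHARGED — the bordered matrix by `isUnit_kkt_dcon`, `G⁻¹ > 0` by [g14's]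
`Ginv_posDef_of_Δa`, `Q_bGQ_bᵀ` by `isUnit_det_QHinvQt`. [cite: Balaban1985BackgroundPropagators, (3.126) p.420, (3.111) p.417] -/
theorem H_eq_3126 [Fintype n] [Fintype m] [Fintype τ] [Fintype b] [Fintype q] [Fintype σ] [DecidableEq n]
    [DecidableEq m] [DecidableEq τ] [DecidableEq b] [DecidableEq q] [DecidableEq σ] (eS : b ≃ σ ⊕ (q ⊕ τ))
    (e : n ≃ τ ⊕ m) (K : Matrix b b ℝ) (hK : Kᵀ = K) (Δ : Matrix n n ℝ) (Q : Matrix m n ℝ) (a : ℝ) (hΔ : Δ.IsSymm)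
    (hΔ' : IsUnit (B9H163.Δ' Δ Q a)) (N : Matrix n τ ℝ) (hQN : Q * N = 0) (hQM : IsUnit (Q * Qᵀ).det)
    (hTs : IsUnit (Nᵀ * (Δ * Δ) * N).det) (D : Matrix b n ℝ) (hD : Dᵀ * D = Δ) (Qb : Matrix q b ℝ)
    (Dbar : Matrix q m ℝ) (h115 : Qb * D = Dbar * Q) (ab : ℝ) (hQbM : IsUnit (Qb * Qbᵀ).det)
    (hΔa : (K + D * B9H163.R Δ Q a * Dᵀ + ab • (Qbᵀ * Qb)).PosDef) (NS : Matrix b σ ℝ)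
    (hSN : dcon Δ N D Qb * NS = 0) (hNSA : IsUnit (NSᵀ * NS).det) :
    hOp K Δ N D Qb = (Ginv K Δ Q a D Qb ab)⁻¹ * Qbᵀ * (Qb * (Ginv K Δ Q a D Qb ab)⁻¹ * Qbᵀ)⁻¹ := by
  have hM' := B9SectECov.isUnit_M' Δ Q a hΔ hΔ' hQM
  have hpos := B9SectDFP.Ginv_posDef_of_Δa K hK Δ Q a hΔ hΔ' hM' D hD Qb Dbar h115 ab hΔa
  have hG : IsUnit (Ginv K Δ Q a D Qb ab).det := (Matrix.isUnit_iff_isUnit_det _).mp hpos.isUnit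
  have hP := isUnit_det_QHinvQt _ hpos Qb hQbM
  have hW := isUnit_kkt_dcon eS e K hK Δ Q a hΔ hΔ' N hQN hQM hTs D hD Qb Dbar h115 ab hQbM hΔa NS hSN hNSA
  ext i j
  have h := congrFun
    (hOp_mulVec_eq_3126 e K Δ Q a hΔ hΔ' N hQN hQM hTs D hD Qb Dbar h115 ab hW hG hP (Pi.single j 1)).2 i
  rw [mulVec_mulVec, mulVec_mulVec, Matrix.mulVec_single_one, Matrix.mulVec_single_one] at h
  exact h

/-- **[an2's] THREE-BLOCK THEOREM, INSTANTIATED BY NAME FOR SECT. D's OBJECTS**: with `K ↦ Δ_π`, `Q ↦ Q_b`, `τ ↦ τ₀ = NᵀΔD*`,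
`W ↦ DN`, `A ↦ (NᵀΔ²N)⁻¹`, `a ↦ a·1` (so that `K + QᵀaQ + τᵀAτ = G⁻¹` by [g14's] `Ginv_eq_slice`),
`Beta.GaugeFixingPropagators.inv_mul_transpose_mul_blockProp_inv` reads: `GQ_bᵀ(Q_bGQ_bᵀ)⁻¹` = the `B`-column block of
the constrained minimiser of `Δ_π` on `{SA = (B, 0)}` — every hypothesis (`Δ_π·DN = Δ_πᵀ·DN = 0`, `Q_b·DN = 0`,
`τ₀·DN` nonsingular, the bordered matrix of `(Δ_π, S)` nonsingular since `Δ_a(Δ_π) = G⁻¹ > 0`) DISCHARGED from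
`Δ_a > 0` and (3.115). [cite: Balaban1985BackgroundPropagators, (3.126) p.420, (3.119)-(3.122) pp.419-420] -/
theorem eq_3126_threeBlock [Fintype n] [Fintype m] [Fintype τ] [Fintype b] [Fintype q] [Fintype σ] [DecidableEq n]
    [DecidableEq m] [DecidableEq τ] [DecidableEq b] [DecidableEq q] [DecidableEq σ] (eS : b ≃ σ ⊕ (q ⊕ τ))
    (e : n ≃ τ ⊕ m) (K : Matrix b b ℝ) (hK : Kᵀ = K) (Δ : Matrix n n ℝ) (Q : Matrix m n ℝ) (a : ℝ) (hΔ : Δ.IsSymm)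
    (hΔ' : IsUnit (B9H163.Δ' Δ Q a)) (N : Matrix n τ ℝ) (hQN : Q * N = 0) (hQM : IsUnit (Q * Qᵀ).det)
    (hTs : IsUnit (Nᵀ * (Δ * Δ) * N).det) (D : Matrix b n ℝ) (hD : Dᵀ * D = Δ) (Qb : Matrix q b ℝ)
    (Dbar : Matrix q m ℝ) (h115 : Qb * D = Dbar * Q) (ab : ℝ) (hQbM : IsUnit (Qb * Qbᵀ).det)
    (hΔa : (K + D * B9H163.R Δ Q a * Dᵀ + ab • (Qbᵀ * Qb)).PosDef) (NS : Matrix b σ ℝ)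
    (hSN : dcon Δ N D Qb * NS = 0) (hNSA : IsUnit (NSᵀ * NS).det) :
    (Ginv K Δ Q a D Qb ab)⁻¹ * Qbᵀ * (blockProp (Ginv K Δ Q a D Qb ab) Qb)⁻¹ =
      (minOp (piOp K Δ Q a D) (dcon Δ N D Qb)).toCols₁ := by
  have hM' := B9SectECov.isUnit_M' Δ Q a hΔ hΔ' hQM
  have hpos := B9SectDFP.Ginv_posDef_of_Δa K hK Δ Q a hΔ hΔ' hM' D hD Qb Dbar h115 ab hΔa
  have hG : IsUnit (Ginv K Δ Q a D Qb ab).det := (Matrix.isUnit_iff_isUnit_det _).mp hpos.isUnit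
  have hslice := B9SectDFP.Ginv_eq_slice e K Δ Q a hΔ hΔ' N hQN hQM hTs D Qb ab
  have hKW := B9SectDFP.piOp_mul_gauge K Δ Q a hΔ' N hQN D hD
  have hQW : Qb * (D * N) = 0 := by rw [← Matrix.mul_assoc, h115, Matrix.mul_assoc, hQN, Matrix.mul_zero]
  have hT : IsUnit (slice Δ N D * (D * N)).det := by rw [slice_mul_gauge Δ N D hD]; exact hTs
  have hA : IsUnit ((Nᵀ * (Δ * Δ) * N)⁻¹).det := isUnit_nonsing_inv_det _ hTs
  have hπt : (piOp K Δ Q a D)ᵀ = piOp K Δ Q a D := by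
    rw [B9SectDFP.piOp, transpose_mul, transpose_mul, transpose_transpose, hK, Matrix.mul_assoc]
  have hΔaπ : (piOp K Δ Q a D + D * B9H163.R Δ Q a * Dᵀ + ab • (Qbᵀ * Qb)).PosDef := by
    have h0 := hpos
    rwa [B9SectDFP.Ginv] at h0
  have hTπ := kernelForm_posDef e (piOp K Δ Q a D) hπt Δ Q a hΔ hΔ' N hQN hQM hTs D Qb ab hΔaπ NS hSN hNSA
  have h : IsUnit (kkt (piOp K Δ Q a D) (dcon Δ N D Qb)).det :=
    isUnit_kkt_det_of_kernelBasis eS _ _ NS hSN hNSA (dcon_gram Δ Q N hQN hTs D hD Qb Dbar h115 hQbM)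
      ((Matrix.isUnit_iff_isUnit_det _).mp hTπ.isUnit)
  have hG' : IsUnit (piOp K Δ Q a D + Qbᵀ * (ab • (1 : Matrix q q ℝ)) * Qb +
      (slice Δ N D)ᵀ * (Nᵀ * (Δ * Δ) * N)⁻¹ * slice Δ N D).det := by
    rw [slice, ← hslice]; exact hG
  have h1 := Beta.GaugeFixingPropagators.inv_mul_transpose_mul_blockProp_inv (piOp K Δ Q a D) Qb (slice Δ N D)
    (D * N) ((Nᵀ * (Δ * Δ) * N)⁻¹) (ab • (1 : Matrix q q ℝ)) hKW.1 hKW.2 hQW hT hA h hG'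
  rw [slice, ← hslice] at h1
  exact h1

/-- COROLLARY: *the extension (3.118)–(3.119) does not move the δ-gauge minimiser* — the `B`-column block of the
constrained minimiser of `Δ_π` on (3.110) equals that of `K` (= `H`): both are `GQ*(QGQ*)⁻¹`.
[cite: Balaban1985BackgroundPropagators, (3.126) p.420, (3.118)-(3.119) p.419] -/
theorem minOp_piOp_eq_hOp [Fintype n] [Fintype m] [Fintype τ] [Fintype b] [Fintype q] [Fintype σ] [DecidableEq n]
    [DecidableEq m] [DecidableEq τ] [DecidableEq b] [DecidableEq q] [DecidableEq σ] (eS : b ≃ σ ⊕ (q ⊕ τ))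
    (e : n ≃ τ ⊕ m) (K : Matrix b b ℝ) (hK : Kᵀ = K) (Δ : Matrix n n ℝ) (Q : Matrix m n ℝ) (a : ℝ) (hΔ : Δ.IsSymm)
    (hΔ' : IsUnit (B9H163.Δ' Δ Q a)) (N : Matrix n τ ℝ) (hQN : Q * N = 0) (hQM : IsUnit (Q * Qᵀ).det)
    (hTs : IsUnit (Nᵀ * (Δ * Δ) * N).det) (D : Matrix b n ℝ) (hD : Dᵀ * D = Δ) (Qb : Matrix q b ℝ)
    (Dbar : Matrix q m ℝ) (h115 : Qb * D = Dbar * Q) (ab : ℝ) (hQbM : IsUnit (Qb * Qbᵀ).det)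
    (hΔa : (K + D * B9H163.R Δ Q a * Dᵀ + ab • (Qbᵀ * Qb)).PosDef) (NS : Matrix b σ ℝ)
    (hSN : dcon Δ N D Qb * NS = 0) (hNSA : IsUnit (NSᵀ * NS).det) :
    (minOp (piOp K Δ Q a D) (dcon Δ N D Qb)).toCols₁ = hOp K Δ N D Qb := by
  rw [← eq_3126_threeBlock eS e K hK Δ Q a hΔ hΔ' N hQN hQM hTs D hD Qb Dbar h115 ab hQbM hΔa NS hSN hNSA,
    H_eq_3126 eS e K hK Δ Q a hΔ hΔ' N hQN hQM hTs D hD Qb Dbar h115 ab hQbM hΔa NS hSN hNSA, Beta.Composition.blockProp]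

end Propagator

/-! ## §5  (3.159) and the first step of (3.156): the inner `δ(QA − B)δ_R(RD\*A)` Gaussian representation with a
`B`-INDEPENDENT normalisation, and `⟨H₁B, G₁⁻¹H₁B⟩ = ⟨B, (QG₁Q\*)⁻¹B⟩` -/

section Representation

variable {n m τ b q σ : Type*}

/-- **(3.159) AT MEASURE LEVEL.**  p. 428: *"we replace the exponential with the first two quadratic forms by the
integral representation … Z_k⁻¹∫dA δ(QA − B)δ_R(RD\*A) exp[−½⟨A,(Δ + Δ^{(2)})A⟩]"* = (3.155)'s
*"exp[−½⟨H₁B, G₁⁻¹H₁B⟩ + ½a⟨B,B⟩]"*.  KERNEL FORM, for EVERY symmetric bond form `K♯` with `Δ_a(K♯) > 0` (instance: the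
matrix `K − 2𝒞` of the form (3.127), [g14's] `B9Eq3152.G1inv`; `H ↦ H₁`, `G⁻¹ ↦ G₁⁻¹`): over the double fibre through
`A₀` (`RD*A₀ = 0`, `B := Q_bA₀`), `∫dz e^{−½⟨A,K♯A⟩} = 𝒩 · exp[−½⟨HB, G⁻¹HB⟩ + ½a⟨B,B⟩]` with
`𝒩 = (√2π)^{dim}/√det(N_SᵀK♯N_S)` INDEPENDENT OF `B` — so `Z_k := 𝒩` (times the untracked constant Jacobian) is the
constant the print divides by.  Exponent: `⟨HB, K♯HB⟩ = ⟨HB, G⁻¹HB⟩ − a‖B‖²` (`Ginv_quadForm_gaugeFixed`, `RD*HB = 0`,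
`Q_bHB = B`). [cite: Balaban1985BackgroundPropagators, (3.159) p.428, (3.155) p.427] -/
theorem eq_3159 [Fintype n] [Fintype m] [Fintype τ] [Fintype b] [Fintype q] [Fintype σ] [DecidableEq n]
    [DecidableEq m] [DecidableEq τ] [DecidableEq b] [DecidableEq q] [DecidableEq σ] (eS : b ≃ σ ⊕ (q ⊕ τ))
    (e : n ≃ τ ⊕ m) (K : Matrix b b ℝ) (hK : Kᵀ = K) (Δ : Matrix n n ℝ) (Q : Matrix m n ℝ) (a : ℝ) (hΔ : Δ.IsSymm)
    (hΔ' : IsUnit (B9H163.Δ' Δ Q a)) (N : Matrix n τ ℝ) (hQN : Q * N = 0) (hQM : IsUnit (Q * Qᵀ).det)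
    (hTs : IsUnit (Nᵀ * (Δ * Δ) * N).det) (D : Matrix b n ℝ) (hD : Dᵀ * D = Δ) (Qb : Matrix q b ℝ)
    (Dbar : Matrix q m ℝ) (h115 : Qb * D = Dbar * Q) (ab : ℝ) (hQbM : IsUnit (Qb * Qbᵀ).det)
    (hΔa : (K + D * B9H163.R Δ Q a * Dᵀ + ab • (Qbᵀ * Qb)).PosDef) (NS : Matrix b σ ℝ)
    (hSN : dcon Δ N D Qb * NS = 0) (hNSA : IsUnit (NSᵀ * NS).det) (A₀ : b → ℝ)
    (hA₀ : B9H163.R Δ Q a *ᵥ (Dᵀ *ᵥ A₀) = 0) :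
    ∫ z : σ → ℝ, Real.exp (-(1/2 : ℝ) * ((A₀ + NS *ᵥ z) ⬝ᵥ K *ᵥ (A₀ + NS *ᵥ z))) =
      (Real.sqrt (2 * π) ^ Fintype.card σ / Real.sqrt (NSᵀ * K * NS).det) *
        Real.exp (-(1/2 : ℝ) * ((hOp K Δ N D Qb *ᵥ (Qb *ᵥ A₀)) ⬝ᵥ Ginv K Δ Q a D Qb ab *ᵥ
            (hOp K Δ N D Qb *ᵥ (Qb *ᵥ A₀))) + (1/2 : ℝ) * (ab * ((Qb *ᵥ A₀) ⬝ᵥ (Qb *ᵥ A₀)))) := by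
  have hW := isUnit_kkt_dcon eS e K hK Δ Q a hΔ hΔ' N hQN hQM hTs D hD Qb Dbar h115 ab hQbM hΔa NS hSN hNSA
  have hfeas := hOp_feasible e K Δ Q a hΔ hΔ' N hQN hQM hTs D Qb hW (Qb *ᵥ A₀)
  rw [Z_eq eS e K hK Δ Q a hΔ hΔ' N hQN hQM hTs D hD Qb Dbar h115 ab hQbM hΔa NS hSN hNSA A₀ hA₀,
    Ginv_quadForm_gaugeFixed K Δ Q a D Qb ab _ hfeas.2, hfeas.1]
  congr 2
  ring

/-- **(3.159) IN THE PRINT'S SHAPE**: `exp[−½⟨HB, G⁻¹HB⟩ + ½a⟨B,B⟩] = Z_k⁻¹ ∫dz e^{−½⟨A,K♯A⟩}`, `Z_k = 𝒩`.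
[cite: Balaban1985BackgroundPropagators, (3.159) p.428] -/
theorem eq_3159_print [Fintype n] [Fintype m] [Fintype τ] [Fintype b] [Fintype q] [Fintype σ] [DecidableEq n]
    [DecidableEq m] [DecidableEq τ] [DecidableEq b] [DecidableEq q] [DecidableEq σ] (eS : b ≃ σ ⊕ (q ⊕ τ))
    (e : n ≃ τ ⊕ m) (K : Matrix b b ℝ) (hK : Kᵀ = K) (Δ : Matrix n n ℝ) (Q : Matrix m n ℝ) (a : ℝ) (hΔ : Δ.IsSymm)
    (hΔ' : IsUnit (B9H163.Δ' Δ Q a)) (N : Matrix n τ ℝ) (hQN : Q * N = 0) (hQM : IsUnit (Q * Qᵀ).det)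
    (hTs : IsUnit (Nᵀ * (Δ * Δ) * N).det) (D : Matrix b n ℝ) (hD : Dᵀ * D = Δ) (Qb : Matrix q b ℝ)
    (Dbar : Matrix q m ℝ) (h115 : Qb * D = Dbar * Q) (ab : ℝ) (hQbM : IsUnit (Qb * Qbᵀ).det)
    (hΔa : (K + D * B9H163.R Δ Q a * Dᵀ + ab • (Qbᵀ * Qb)).PosDef) (NS : Matrix b σ ℝ)
    (hSN : dcon Δ N D Qb * NS = 0) (hNSA : IsUnit (NSᵀ * NS).det) (A₀ : b → ℝ)
    (hA₀ : B9H163.R Δ Q a *ᵥ (Dᵀ *ᵥ A₀) = 0) :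
    Real.exp (-(1/2 : ℝ) * ((hOp K Δ N D Qb *ᵥ (Qb *ᵥ A₀)) ⬝ᵥ Ginv K Δ Q a D Qb ab *ᵥ
        (hOp K Δ N D Qb *ᵥ (Qb *ᵥ A₀))) + (1/2 : ℝ) * (ab * ((Qb *ᵥ A₀) ⬝ᵥ (Qb *ᵥ A₀)))) =
      (Real.sqrt (2 * π) ^ Fintype.card σ / Real.sqrt (NSᵀ * K * NS).det)⁻¹ *
        ∫ z : σ → ℝ, Real.exp (-(1/2 : ℝ) * ((A₀ + NS *ᵥ z) ⬝ᵥ K *ᵥ (A₀ + NS *ᵥ z))) := by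
  rw [eq_3159 eS e K hK Δ Q a hΔ hΔ' N hQN hQM hTs D hD Qb Dbar h115 ab hQbM hΔa NS hSN hNSA A₀ hA₀,
    inv_mul_cancel_left₀ (B9SectECov.gaussNorm_pos
      (kernelForm_posDef e K hK Δ Q a hΔ hΔ' N hQN hQM hTs D Qb ab hΔa NS hSN hNSA)).ne']

/-- **THE FIRST STEP OF (3.156)**: `⟨HB, G⁻¹HB⟩ = ⟨B, (Q_bGQ_bᵀ)⁻¹B⟩` for `H = GQ_bᵀ(Q_bGQ_bᵀ)⁻¹` — [r1-g4's]
`B9SectEKernel.extension_energy` with its hypotheses `QH = 1`, `SH = Q*P` DISCHARGED (`minOp_quadForm`), transported to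
the minimiser `H` of (3.109)–(3.110) by `hOp_mulVec_eq_3126`.  (In (3.156) this is the `⟨B,(QG₁Q*)⁻¹B⟩` term; the
`J`-dependent terms of (3.155)–(3.156) are not treated here.) [cite: Balaban1985BackgroundPropagators, (3.156) p.428, (3.126) p.420] -/
theorem eq_3156_energy [Fintype n] [Fintype m] [Fintype τ] [Fintype b] [Fintype q] [DecidableEq n] [DecidableEq m]
    [DecidableEq τ] [DecidableEq b] [DecidableEq q] (e : n ≃ τ ⊕ m) (K : Matrix b b ℝ) (Δ : Matrix n n ℝ)
    (Q : Matrix m n ℝ) (a : ℝ) (hΔ : Δ.IsSymm) (hΔ' : IsUnit (B9H163.Δ' Δ Q a)) (N : Matrix n τ ℝ)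
    (hQN : Q * N = 0) (hQM : IsUnit (Q * Qᵀ).det) (hTs : IsUnit (Nᵀ * (Δ * Δ) * N).det) (D : Matrix b n ℝ)
    (hD : Dᵀ * D = Δ) (Qb : Matrix q b ℝ) (Dbar : Matrix q m ℝ) (h115 : Qb * D = Dbar * Q) (ab : ℝ)
    (hW : IsUnit (kkt K (dcon Δ N D Qb)).det) (hG : IsUnit (Ginv K Δ Q a D Qb ab).det)
    (hP : IsUnit (Qb * (Ginv K Δ Q a D Qb ab)⁻¹ * Qbᵀ).det) (B : q → ℝ) :
    (hOp K Δ N D Qb *ᵥ B) ⬝ᵥ Ginv K Δ Q a D Qb ab *ᵥ (hOp K Δ N D Qb *ᵥ B) =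
      B ⬝ᵥ (Qb * (Ginv K Δ Q a D Qb ab)⁻¹ * Qbᵀ)⁻¹ *ᵥ B := by
  rw [(hOp_mulVec_eq_3126 e K Δ Q a hΔ hΔ' N hQN hQM hTs D hD Qb Dbar h115 ab hW hG hP B).1]
  exact minOp_quadForm (Ginv K Δ Q a D Qb ab) Qb hG hP B

/-- **THE MINIMUM VALUE OF (3.109) ON (3.110)**: `⟨HB, K·HB⟩ = ⟨B, (Q_bGQ_bᵀ)⁻¹B⟩ − a⟨B, B⟩` — (3.111) at the minimiser
combined with `eq_3156_energy`; with `K♯ = K − 2𝒞` this is the `B`-quadratic part `−½⟨B,(QG₁Q*)⁻¹B⟩ + ½a⟨B,B⟩` of the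
exponent (3.156). [cite: Balaban1985BackgroundPropagators, (3.156) p.428, (3.111) p.417] -/
theorem min_3109_value [Fintype n] [Fintype m] [Fintype τ] [Fintype b] [Fintype q] [DecidableEq n] [DecidableEq m]
    [DecidableEq τ] [DecidableEq b] [DecidableEq q] (e : n ≃ τ ⊕ m) (K : Matrix b b ℝ) (Δ : Matrix n n ℝ)
    (Q : Matrix m n ℝ) (a : ℝ) (hΔ : Δ.IsSymm) (hΔ' : IsUnit (B9H163.Δ' Δ Q a)) (N : Matrix n τ ℝ)
    (hQN : Q * N = 0) (hQM : IsUnit (Q * Qᵀ).det) (hTs : IsUnit (Nᵀ * (Δ * Δ) * N).det) (D : Matrix b n ℝ)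
    (hD : Dᵀ * D = Δ) (Qb : Matrix q b ℝ) (Dbar : Matrix q m ℝ) (h115 : Qb * D = Dbar * Q) (ab : ℝ)
    (hW : IsUnit (kkt K (dcon Δ N D Qb)).det) (hG : IsUnit (Ginv K Δ Q a D Qb ab).det)
    (hP : IsUnit (Qb * (Ginv K Δ Q a D Qb ab)⁻¹ * Qbᵀ).det) (B : q → ℝ) :
    (hOp K Δ N D Qb *ᵥ B) ⬝ᵥ K *ᵥ (hOp K Δ N D Qb *ᵥ B) =
      B ⬝ᵥ (Qb * (Ginv K Δ Q a D Qb ab)⁻¹ * Qbᵀ)⁻¹ *ᵥ B - ab * (B ⬝ᵥ B) := by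
  have hfeas := hOp_feasible e K Δ Q a hΔ hΔ' N hQN hQM hTs D Qb hW B
  have h := Ginv_quadForm_gaugeFixed K Δ Q a D Qb ab (hOp K Δ N D Qb *ᵥ B) hfeas.2
  rw [hfeas.1, eq_3156_energy e K Δ Q a hΔ hΔ' N hQN hQM hTs D hD Qb Dbar h115 ab hW hG hP B] at h
  linarith

end Representation

end Literature.MathematicalPhysics.QuantumFieldTheory.Balaban1983to89.B9Eq3112
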